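import Mathlib.Analysis.PSeries
import Mathlib.Analysis.SpecialFunctions.Pow.Asymptotics
import Mathlib.NumberTheory.ArithmeticFunction.Misc
import Literature.NumberTheory.Sieve.AsymptoticSieveForPrimes
import Literature.NumberTheory.Sieve.DivisorPowerSums
import Literature.NumberTheory.LFunctions.MertensSecondLogPower
import Literature.NumberTheory.LFunctions.TaoLogChowlaMoebiusOfLiouville
import HarnessLib

/-!
# The literal reading of Friedlander–Iwaniec's Theorem 1 is false: a proved counterexample

Topic `Literature/NumberTheory/Sieve` (trunk T-SIEVE), companion of `AsymptoticSieveForPrimes.lean`.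
That file vendors the hypotheses of J. Friedlander, H. Iwaniec, *Asymptotic sieve for primes*, Ann.
of Math. 148 (1998) 1041–1065, Theorem 1 (`SieveSequence.FIAsymptoticSieveHypotheses`). Read as the
printed sentence reads ((B): "for some `δ = δ(x) ≥ 2` and `Δ = Δ(x) ≥ 2`"; Theorem 1: "Assuming the
above hypotheses, we have (1.17)") — over ALL parameter functions `δ, Δ ≥ 2` — the conclusion (1.17)
`∑_{p ≤ x} a_p log p = H A(x)(1 + O(log δ(x) / log Δ(x)))` is FALSE, and this file PROVES it. (That
literal reading was vendored in `AsymptoticSieveForPrimes.lean` as the named fact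
`fi_asymptotic_sieve_primes`, retired as REFUTED by the D-0026 verdict clean-up of 2026-08-15; so that
the `def` can be deleted, its statement is spelled out here verbatim, negated, as the type of the two
theorems below, which therefore do not mention it.) FI themselves continue (p. 1044)
"In practice (B) can be established in the range (B1) for `δ = (log x)^α` and `Δ = x^η` ... If
`log δ(x) ≫ log Δ(x)` then the error term exceeds the main term and (1.17) follows from the upper
bound sieve. Therefore for the proof we may assume that `x > Δ(x)^A`, `Δ(x) > δ(x)^A`, and
`δ(x) > A`", and the theorem in that regime is the corrected fact
`Literature.NumberTheory.Sieve.fi_asymptotic_sieve_primes_loglog`, PROVED in the tree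
(`Literature.NumberTheory.Sieve.fi_asymptotic_sieve_primes_loglog_holds`, `AsymptoticSieveForPrimesTheorem1.lean`,
from `fi_asymptotic_sieve_primes_loglog_of_cancellation`, `AsymptoticSieveForPrimesLoglog.lean`).

Everything here is proved, no named facts:

* `Literature.NumberTheory.Sieve.fi_asymptotic_sieve_primes_false : ¬ ∀ A D δ Δ H,
  A.FIAsymptoticSieveHypotheses D δ Δ → A.HasDensityConstant H →
  (∑_{p ≤ x} a_p log p - H A(x)) =O[atTop] (H A(x) log δ(x) / log Δ(x))` (the refuting theorem);
* `Literature.NumberTheory.Sieve.not_fi_asymptotic_sieve_primes`, the same statement under the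
  `not_<decl>` name of the retired fact.

Consequently no result may take the literal reading as a hypothesis (ex falso); consume
`Literature.NumberTheory.Sieve.fi_asymptotic_sieve_primes_loglog` (discharged by `…_loglog_holds`)
instead. Nothing here contradicts Friedlander–Iwaniec's theorem as used (by its authors and in every
citation) with `δ` a power of `log x` and `Δ` a small power of `x`, where `x > Δ^A`; the witness
below has `Δ > x`.

## The counterexample (`namespace Literature.FICounterexample`)

Take `a_n = μ²(n)` (`Literature.NumberTheory.LFunctions.sqfreeInd`; the sequence `sqfreeSeq`), so that `A(x) = Q(x)`, the number
of squarefree `n ≤ x`, with the multiplicative density `g(d) = ∏_{p ∣ d} (p + 1)⁻¹` (`dens`), the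
level `D(x) = x^{3/4}` (`levelFn`) and the parameters `δ(x) = 2√x` (`deltaFn`),
`Δ(x) = exp(x³)` (`bigDeltaFn`). Every clause of `SieveSequence.FIAsymptoticSieveHypotheses`
holds (`hypotheses`):

* (1.4), (1.6): `x/8 ≤ Q(x) ≤ x` (`card_filter_squarefree_ge`: at most `∑_{m ≥ 2} N/m² ≤ 3N/4`
  of the `n ≤ N` are divisible by a square `m² ≥ 4`);
* (1.8): `0 ≤ 1/(p+1) < 1`, `1/(p+1) ≤ 1/p`;
* (1.9) for `g(p) = 1/(p+1) = 1/p - 1/(p(p+1))`: this is Mertens' second theorem WITH THE PRIME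
  NUMBER THEOREM ERROR TERM `O((log y)^{-10})`, PROVED in the tree
  (`Literature.NumberTheory.LFunctions.Mertens.exists_sum_primesLE_inv_loglog`, `MertensSecondLogPower.lean`, from de la Vallée
  Poussin's `ϑ(x) = x + O(x e^{-c√log x})`, `PrimeNumberTheoremErrorTermProofs.lean`), plus the
  convergent correction `∑_p 1/(p(p+1))` (`clause_19`);
* (1.16): by construction; (R1): for `x > 1`;
* (R) with level `x^{3/4}` (`clause_R`): the elementary equidistribution of the squarefree numbers
  in the progressions `0 mod d`, `|Q_d(N) - g(d) Q(N)| ≤ 4 τ(d) + 12 τ(d) √(N/d)` for squarefree `d`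
  (`abs_card_dvd_sub_dens_mul_card_le`: Legendre's formula `N_d(w) = ∑_{e ∣ d} μ(e) ⌊w/e⌋`, the
  squarefree sieve `μ²(k) = ∑_{m² ∣ k} μ(m)` (`Literature.NumberTheory.LFunctions.sqfreeInd_eq_sum_moebius`), the partition of the
  squarefree `n ≤ N` by `(n, d)`, and the identities `g(d) ∑_{e ∣ d} 1/e = 1/d`,
  `g(d) ∑_{e ∣ d} e^{-1/2} ≤ d^{-1/2}`), summed over `d ≤ x^{3/4}` with the divisor-sum bounds of
  `DivisorPowerSums.lean` to `≪ x^{7/8} (log x)^4 ≤ Q(x) (log x)^{-2^{22}}` eventually;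
* (B) holds VACUOUSLY (`clause_B`): the range (B1) `√D/Δ < N < √x/δ = 1/2` leaves no integer in
  `(N, 2N]`, so the bilinear form is an empty sum.

The density constant `H = ∏_p (1 - g(p))(1 - 1/p)⁻¹ = ∏_p p²/(p² - 1)` exists
(`exists_hasDensityConstant`: nondecreasing bounded partial products; its value `ζ(2)` is not
needed). The conclusion (1.17) would give `f(x) = ∑_{p ≤ x} log p - H Q(x) = O(H Q(x) log(2√x)/x³)`,
which is eventually bounded by `2C|H|`; but `f(p) - f(p - 1) = log p - H` at every prime `p`,
a contradiction for `log p > |H| + 4C|H|`.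

## Mathlib / tree

Reused: `Literature.NumberTheory.LFunctions.sqfreeInd`, `Literature.NumberTheory.LFunctions.sqfreeInd_eq_sum_moebius`, `Literature.NumberTheory.LFunctions.sum_Ioc_one_div_sq_le`,
`Literature.NumberTheory.LFunctions.sum_Ioc_one_div_sq_le_two`, `Literature.NumberTheory.LFunctions.sum_mul_sum_filter_comm`, `Literature.NumberTheory.LFunctions.abs_moebius_real_le_one`
(`TaoLogChowlaMoebiusOfLiouville.lean`); `Literature.NumberTheory.Sieve.exists_sum_sigma_zero_pow_le_real`,
`Literature.NumberTheory.Sieve.exists_sum_sigma_zero_pow_div_le_real`, `Literature.NumberTheory.Sieve.one_le_sigma_zero` (`DivisorPowerSums.lean`);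
`Literature.NumberTheory.LFunctions.Mertens.exists_sum_primesLE_inv_loglog`; Mathlib's `Nat.Ioc_filter_dvd_card_eq_div`,
`ArithmeticFunction.prodPrimeFactors`, `IsMultiplicative.prodPrimeFactors_one_add_of_squarefree`,
`Nat.squarefree_mul_iff`, `sum_Ioo_inv_sq_le`, `isLittleO_log_rpow_rpow_atTop`,
`tendsto_atTop_ciSup`, `Finset.sum_mul_sq_le_sq_mul_sq`. Mathlib has no asymptotic count of the
squarefree numbers, let alone in progressions (`rg -l Squarefree Mathlib/NumberTheory`: `SumTwoSquares`,
`SmoothNumbers`, `Primorial`, `ArithmeticFunction/*`, `SelbergSieve`, `MaricaSchoenheim` — none counts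
them); the tree's `TaoLogChowlaMoebiusOfLiouville.lean` has the squarefree sieve identity reused here.

## References

* J. Friedlander, H. Iwaniec, *Asymptotic sieve for primes*, Ann. of Math. 148 (1998), 1041–1065:
  hypotheses (1.4), (1.6)–(1.9), (1.16), (R), (R1), (B), (B1)–(B3), Theorem 1 (1.17), and the
  paragraph after (1.17) on p. 1044. [FriedlanderIwaniecASP1998]
-/

noncomputable section

open Filter Asymptotics Finset Real
open scoped ArithmeticFunction.Moebius ArithmeticFunction.sigma Topology

namespace Literature.NumberTheory.Sieve

namespace FICounterexample

/-! ### Part 1. Legendre's formula for the integers coprime to `d` -/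

/-- `N_d(w) = #{j ∈ (0, w] : (j, d) = 1}`, the number of integers up to `w` coprime to `d`.
[folklore] -/
def coprimeCount (d w : ℕ) : ℕ := ((Ioc 0 w).filter (fun j => Nat.Coprime j d)).card

/-- `N_d(0) = 0`. [folklore] -/
@[simp] theorem coprimeCount_zero (d : ℕ) : coprimeCount d 0 = 0 := by
  simp [coprimeCount]

/-- **Legendre's formula**: `N_d(w) = ∑_{e ∣ d} μ(e) ⌊w/e⌋` for `d ≥ 1`. [folklore] -/
theorem coprimeCount_eq_sum_moebius {d : ℕ} (hd : d ≠ 0) (w : ℕ) :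
    (coprimeCount d w : ℤ) = ∑ e ∈ d.divisors, (μ e : ℤ) * ((w / e : ℕ) : ℤ) := by
  have key : ∀ j : ℕ, j ≠ 0 → (if Nat.Coprime j d then (1 : ℤ) else 0) =
      ∑ e ∈ d.divisors, if e ∣ j then (μ e : ℤ) else 0 := by
    intro j hj
    have h1 := congrArg (fun f : ArithmeticFunction ℤ => f (Nat.gcd j d))
      ArithmeticFunction.moebius_mul_coe_zeta
    simp only [ArithmeticFunction.coe_mul_zeta_apply, ArithmeticFunction.one_apply] at h1
    have hset : d.divisors.filter (fun e => e ∣ j) = (Nat.gcd j d).divisors := by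
      ext e
      simp only [Nat.mem_divisors, Finset.mem_filter, Nat.dvd_gcd_iff]
      constructor
      · rintro ⟨⟨hed, -⟩, hej⟩
        exact ⟨⟨hej, hed⟩, Nat.gcd_ne_zero_right hd⟩
      · rintro ⟨⟨hej, hed⟩, -⟩
        exact ⟨⟨hed, hd⟩, hej⟩
    rw [← Finset.sum_filter, hset, h1]
  unfold coprimeCount
  rw [Finset.card_filter, Nat.cast_sum]
  have h2 : ∀ j ∈ Ioc 0 w, ((if Nat.Coprime j d then 1 else 0 : ℕ) : ℤ) =
      ∑ e ∈ d.divisors, if e ∣ j then (μ e : ℤ) else 0 := by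
    intro j hj
    rw [Finset.mem_Ioc] at hj
    rw [← key j (by omega)]
    split_ifs <;> simp
  rw [Finset.sum_congr rfl h2, Finset.sum_comm]
  refine Finset.sum_congr rfl fun e _ => ?_
  rw [← Finset.sum_filter, Finset.sum_const, nsmul_eq_mul, mul_comm, Nat.Ioc_filter_dvd_card_eq_div]

/-- `κ_d = ∑_{e ∣ d} μ(e)/e` (`= φ(d)/d`, an identification not needed here). [folklore] -/
def kappa (d : ℕ) : ℝ := ∑ e ∈ d.divisors, (μ e : ℝ) / e

/-- `|κ_d| ≤ τ(d)`. [folklore] -/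
theorem abs_kappa_le (d : ℕ) : |kappa d| ≤ (σ 0 d : ℝ) := by
  unfold kappa
  refine (Finset.abs_sum_le_sum_abs _ _).trans ?_
  rw [ArithmeticFunction.sigma_zero_apply]
  calc ∑ e ∈ d.divisors, |(μ e : ℝ) / e| ≤ ∑ e ∈ d.divisors, (1 : ℝ) := by
        refine Finset.sum_le_sum fun e he => ?_
        have he1 : (1 : ℝ) ≤ e := by exact_mod_cast Nat.pos_of_mem_divisors he
        rw [abs_div, abs_of_pos (by linarith : (0 : ℝ) < e)]
        calc |(μ e : ℝ)| / e ≤ 1 / 1 :=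
              div_le_div₀ zero_le_one (LFunctions.abs_moebius_real_le_one e) one_pos he1
          _ = 1 := by norm_num
    _ = (d.divisors.card : ℝ) := by simp

/-- `|⌊w/e⌋ - w/e| ≤ 1` for natural numbers `w`, `e ≥ 1` (natural versus real division). [folklore] -/
theorem abs_natDiv_sub_div_le {e : ℕ} (he : 0 < e) (w : ℕ) :
    |((w / e : ℕ) : ℝ) - (w : ℝ) / e| ≤ 1 := by
  have h1 : ((w / e : ℕ) : ℝ) ≤ (w : ℝ) / e := Nat.cast_div_le
  have h2 : (w : ℝ) / e < ((w / e : ℕ) : ℝ) + 1 := by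
    have h := Nat.lt_div_mul_add (a := w) he
    have he' : (0 : ℝ) < e := by exact_mod_cast he
    rw [div_lt_iff₀ he']
    calc (w : ℝ) < ((w / e * e + e : ℕ) : ℝ) := by exact_mod_cast h
      _ = (((w / e : ℕ) : ℝ) + 1) * e := by push_cast; ring
  rw [abs_le]
  constructor <;> linarith

/-- **Legendre with the error term**: `|N_d(w) - κ_d w| ≤ τ(d)` for `d ≥ 1`. [folklore] -/
theorem abs_coprimeCount_sub_le {d : ℕ} (hd : d ≠ 0) (w : ℕ) :
    |(coprimeCount d w : ℝ) - kappa d * w| ≤ (σ 0 d : ℝ) := by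
  have h := coprimeCount_eq_sum_moebius hd w
  have h' : (coprimeCount d w : ℝ) = ∑ e ∈ d.divisors, (μ e : ℝ) * ((w / e : ℕ) : ℝ) := by
    have := congrArg (Int.cast : ℤ → ℝ) h
    push_cast at this
    exact this
  rw [h', kappa, Finset.sum_mul, ← Finset.sum_sub_distrib, ArithmeticFunction.sigma_zero_apply]
  refine (Finset.abs_sum_le_sum_abs _ _).trans ?_
  calc ∑ e ∈ d.divisors, |(μ e : ℝ) * ((w / e : ℕ) : ℝ) - (μ e : ℝ) / e * w|
      ≤ ∑ e ∈ d.divisors, (1 : ℝ) := by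
        refine Finset.sum_le_sum fun e he => ?_
        have he0 : 0 < e := Nat.pos_of_mem_divisors he
        rw [show (μ e : ℝ) * ((w / e : ℕ) : ℝ) - (μ e : ℝ) / e * w =
            (μ e : ℝ) * (((w / e : ℕ) : ℝ) - (w : ℝ) / e) by ring, abs_mul]
        calc |(μ e : ℝ)| * |((w / e : ℕ) : ℝ) - (w : ℝ) / e| ≤ 1 * 1 :=
              mul_le_mul (LFunctions.abs_moebius_real_le_one e) (abs_natDiv_sub_div_le he0 w)
                (abs_nonneg _) zero_le_one
          _ = 1 := one_mul _
    _ = (d.divisors.card : ℝ) := by simp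

/-! ### Part 2. Squarefree integers coprime to `d` -/

/-- `F_d(M) = #{k ∈ (0, M] : k squarefree, (k, d) = 1}`. [folklore] -/
def sqfreeCoprimeCount (d M : ℕ) : ℕ :=
  ((Ioc 0 M).filter (fun k => Squarefree k ∧ Nat.Coprime k d)).card

/-- For `m ≥ 1`: `#{k ∈ (0, M] : (k, d) = 1, m² ∣ k} = N_d(⌊M/m²⌋)` if `(m, d) = 1`, and `= 0`
otherwise (`k = m² j`). [folklore] -/
theorem card_filter_coprime_sq_dvd {d M m : ℕ} (hm : m ≠ 0) :
    (((Ioc 0 M).filter (fun k => Nat.Coprime k d)).filter (fun k => m ^ 2 ∣ k)).card =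
      if Nat.Coprime m d then coprimeCount d (M / m ^ 2) else 0 := by
  have hm2 : 0 < m ^ 2 := by positivity
  split_ifs with hcop
  · unfold coprimeCount
    rw [Finset.filter_filter]
    have hset : ((Ioc 0 M).filter fun k => Nat.Coprime k d ∧ m ^ 2 ∣ k) =
        ((Ioc 0 (M / m ^ 2)).filter fun j => Nat.Coprime j d).map
          ⟨fun j => m ^ 2 * j, mul_right_injective₀ hm2.ne'⟩ := by
      ext k
      simp only [Finset.mem_filter, Finset.mem_Ioc, Finset.mem_map, Function.Embedding.coeFn_mk]
      constructor
      · rintro ⟨⟨hk0, hkM⟩, hkd, ⟨j, rfl⟩⟩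
        refine ⟨j, ⟨⟨Nat.pos_of_mul_pos_left hk0, ?_⟩, Nat.Coprime.coprime_mul_left hkd⟩, rfl⟩
        exact (Nat.le_div_iff_mul_le hm2).2 (by rw [mul_comm]; exact hkM)
      · rintro ⟨j, ⟨⟨hj0, hjM⟩, hjd⟩, rfl⟩
        refine ⟨⟨by positivity, ?_⟩, Nat.Coprime.mul_left (hcop.pow_left 2) hjd, dvd_mul_right _ _⟩
        calc m ^ 2 * j ≤ m ^ 2 * (M / m ^ 2) := Nat.mul_le_mul_left _ hjM
          _ ≤ M := Nat.mul_div_le M (m ^ 2)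
    rw [hset, Finset.card_map]
  · rw [Finset.card_eq_zero, Finset.filter_eq_empty_iff]
    intro k hk hmk
    rw [Finset.mem_filter] at hk
    exact hcop (Nat.Coprime.coprime_dvd_left ((dvd_pow_self m two_ne_zero).trans hmk) hk.2)

/-- **The squarefree sieve for `F_d`**: for `M ≤ T`,
`F_d(M) = ∑_{m ≤ T, (m, d) = 1} μ(m) N_d(⌊M/m²⌋)` (from `μ²(k) = ∑_{m² ∣ k} μ(m)`). [folklore] -/
theorem sqfreeCoprimeCount_eq_sum (d : ℕ) {M T : ℕ} (hMT : M ≤ T) :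
    (sqfreeCoprimeCount d M : ℝ) =
      ∑ m ∈ (Icc 1 T).filter (fun m => Nat.Coprime m d),
        (μ m : ℝ) * (coprimeCount d (M / m ^ 2) : ℝ) := by
  unfold sqfreeCoprimeCount
  have h1 : ((((Ioc 0 M).filter fun k => Squarefree k ∧ Nat.Coprime k d)).card : ℝ) =
      ∑ k ∈ (Ioc 0 M).filter (fun k => Nat.Coprime k d), LFunctions.sqfreeInd k := by
    have hs : ((Ioc 0 M).filter fun k => Squarefree k ∧ Nat.Coprime k d) =
        ((Ioc 0 M).filter fun k => Nat.Coprime k d).filter Squarefree := by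
      ext k
      simp only [Finset.mem_filter]
      tauto
    rw [hs, Finset.card_filter, Nat.cast_sum]
    refine Finset.sum_congr rfl fun k _ => ?_
    unfold LFunctions.sqfreeInd
    split_ifs <;> simp
  rw [h1]
  have h2 : ∀ k ∈ (Ioc 0 M).filter (fun k => Nat.Coprime k d),
      LFunctions.sqfreeInd k = ∑ m ∈ (Icc 1 T).filter (fun m => m ^ 2 ∣ k), (μ m : ℝ) := by
    intro k hk
    rw [Finset.mem_filter, Finset.mem_Ioc] at hk
    exact LFunctions.sqfreeInd_eq_sum_moebius hk.1.1 (hk.1.2.trans hMT)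
  rw [Finset.sum_congr rfl h2]
  have h3 := LFunctions.sum_mul_sum_filter_comm (A := Icc 1 T)
    (B := (Ioc 0 M).filter (fun k => Nat.Coprime k d)) (fun m k => m ^ 2 ∣ k)
    (fun _ => (1 : ℝ)) (fun m => (μ m : ℝ))
  simp only [one_mul] at h3
  rw [h3, Finset.sum_filter]
  refine Finset.sum_congr rfl fun m hm => ?_
  have hm0 : m ≠ 0 := by rw [Finset.mem_Icc] at hm; omega
  rw [Finset.sum_const, nsmul_eq_mul, mul_one, card_filter_coprime_sq_dvd hm0]
  split_ifs <;> simp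

/-- `α_d^{(T)} = κ_d ∑_{m ≤ T, (m, d) = 1} μ(m)/m²`, the (truncated) density of the squarefree
integers coprime to `d`. [folklore] -/
def alpha (d T : ℕ) : ℝ :=
  kappa d * ∑ m ∈ (Icc 1 T).filter (fun m => Nat.Coprime m d), (μ m : ℝ) / (m : ℝ) ^ 2

/-- `|α_d^{(T)}| ≤ 2 τ(d)`. [folklore] -/
theorem abs_alpha_le (d T : ℕ) : |alpha d T| ≤ 2 * (σ 0 d : ℝ) := by
  unfold alpha
  rw [abs_mul]
  have h2 : |∑ m ∈ (Icc 1 T).filter (fun m => Nat.Coprime m d), (μ m : ℝ) / (m : ℝ) ^ 2| ≤ 2 := by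
    refine (Finset.abs_sum_le_sum_abs _ _).trans ?_
    calc ∑ m ∈ (Icc 1 T).filter (fun m => Nat.Coprime m d), |(μ m : ℝ) / (m : ℝ) ^ 2|
        ≤ ∑ m ∈ (Icc 1 T).filter (fun m => Nat.Coprime m d), (1 : ℝ) / (m : ℝ) ^ 2 := by
          refine Finset.sum_le_sum fun m _ => ?_
          rw [abs_div, abs_of_nonneg (by positivity : (0 : ℝ) ≤ (m : ℝ) ^ 2)]
          exact div_le_div_of_nonneg_right (LFunctions.abs_moebius_real_le_one m) (by positivity)
      _ ≤ ∑ m ∈ Icc 1 T, (1 : ℝ) / (m : ℝ) ^ 2 :=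
          Finset.sum_le_sum_of_subset_of_nonneg (Finset.filter_subset _ _)
            fun _ _ _ => by positivity
      _ = ∑ m ∈ Ioc 0 T, (1 : ℝ) / (m : ℝ) ^ 2 := by
          rw [show Icc 1 T = Ioc 0 T by ext m; simp only [Finset.mem_Icc, Finset.mem_Ioc]; omega]
      _ ≤ 2 := LFunctions.sum_Ioc_one_div_sq_le_two T
  calc |kappa d| * |∑ m ∈ (Icc 1 T).filter (fun m => Nat.Coprime m d), (μ m : ℝ) / (m : ℝ) ^ 2|
      ≤ (σ 0 d : ℝ) * 2 := mul_le_mul (abs_kappa_le d) h2 (abs_nonneg _) (by positivity)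
    _ = 2 * (σ 0 d : ℝ) := mul_comm _ _

/-- `∑_{1 ≤ m ≤ T} min(1, M/m²) ≤ 3 √M`. [folklore] -/
theorem sum_min_one_div_sq_le (M T : ℕ) :
    ∑ m ∈ Icc 1 T, min (1 : ℝ) ((M : ℝ) / (m : ℝ) ^ 2) ≤ 3 * Real.sqrt M := by
  set s := Nat.sqrt M with hs
  have hsM : (s : ℝ) ≤ Real.sqrt M := by
    rw [Real.le_sqrt (Nat.cast_nonneg _) (Nat.cast_nonneg _)]
    exact_mod_cast Nat.sqrt_le' M
  have hMs : Real.sqrt M ≤ (s : ℝ) + 1 := by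
    rw [Real.sqrt_le_left (by positivity)]
    exact_mod_cast (Nat.lt_succ_sqrt' M).le
  have hsplit : ∑ m ∈ Icc 1 T, min (1 : ℝ) ((M : ℝ) / (m : ℝ) ^ 2) ≤
      ∑ m ∈ Icc 1 s, min (1 : ℝ) ((M : ℝ) / (m : ℝ) ^ 2) +
        ∑ m ∈ Ioc s T, min (1 : ℝ) ((M : ℝ) / (m : ℝ) ^ 2) := by
    rw [← Finset.sum_union]
    · refine Finset.sum_le_sum_of_subset_of_nonneg ?_ fun _ _ _ => by positivity
      intro m hm
      rw [Finset.mem_union, Finset.mem_Icc, Finset.mem_Ioc]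
      rw [Finset.mem_Icc] at hm
      omega
    · rw [Finset.disjoint_left]
      intro m hm1 hm2
      rw [Finset.mem_Icc] at hm1
      rw [Finset.mem_Ioc] at hm2
      omega
  have hA : ∑ m ∈ Icc 1 s, min (1 : ℝ) ((M : ℝ) / (m : ℝ) ^ 2) ≤ s := by
    calc ∑ m ∈ Icc 1 s, min (1 : ℝ) ((M : ℝ) / (m : ℝ) ^ 2) ≤ ∑ m ∈ Icc 1 s, (1 : ℝ) :=
          Finset.sum_le_sum fun _ _ => min_le_left _ _
      _ = s := by simp
  have hB : ∑ m ∈ Ioc s T, min (1 : ℝ) ((M : ℝ) / (m : ℝ) ^ 2) ≤ 2 * Real.sqrt M := by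
    calc ∑ m ∈ Ioc s T, min (1 : ℝ) ((M : ℝ) / (m : ℝ) ^ 2)
        ≤ ∑ m ∈ Ioo s (T + 1), (M : ℝ) * ((m : ℝ) ^ 2)⁻¹ := by
          rw [show Ioc s T = Ioo s (T + 1) by ext m; simp only [Finset.mem_Ioc, Finset.mem_Ioo]; omega]
          exact Finset.sum_le_sum fun m _ => (min_le_right _ _).trans_eq (div_eq_mul_inv _ _)
      _ = (M : ℝ) * ∑ m ∈ Ioo s (T + 1), ((m : ℝ) ^ 2)⁻¹ := (Finset.mul_sum _ _ _).symm
      _ ≤ (M : ℝ) * (2 / ((s : ℝ) + 1)) :=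
          mul_le_mul_of_nonneg_left (sum_Ioo_inv_sq_le s (T + 1)) (Nat.cast_nonneg _)
      _ ≤ 2 * Real.sqrt M := by
          rw [mul_div_assoc', div_le_iff₀ (by positivity)]
          calc (M : ℝ) * 2 = 2 * (Real.sqrt M * Real.sqrt M) := by
                rw [Real.mul_self_sqrt (Nat.cast_nonneg _)]; ring
            _ ≤ 2 * (Real.sqrt M * ((s : ℝ) + 1)) := by gcongr
            _ = 2 * Real.sqrt M * ((s : ℝ) + 1) := by ring
  linarith

/-- **The squarefree integers coprime to `d` are equidistributed with square-root error**:
`|F_d(M) - α_d^{(T)} M| ≤ 6 τ(d) √M` for `d ≥ 1` and `M ≤ T`. [folklore] -/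
theorem abs_sqfreeCoprimeCount_sub_le {d M T : ℕ} (hd : d ≠ 0) (hMT : M ≤ T) :
    |(sqfreeCoprimeCount d M : ℝ) - alpha d T * M| ≤ 6 * (σ 0 d : ℝ) * Real.sqrt M := by
  rw [sqfreeCoprimeCount_eq_sum d hMT, alpha]
  set A := (Icc 1 T).filter (fun m => Nat.Coprime m d) with hA
  have hexp : kappa d * (∑ m ∈ A, (μ m : ℝ) / (m : ℝ) ^ 2) * M =
      ∑ m ∈ A, (μ m : ℝ) * (kappa d * ((M : ℝ) / (m : ℝ) ^ 2)) := by
    rw [Finset.mul_sum, Finset.sum_mul]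
    exact Finset.sum_congr rfl fun m _ => by ring
  rw [hexp, ← Finset.sum_sub_distrib]
  have hterm : ∀ m ∈ A, |(μ m : ℝ) * (coprimeCount d (M / m ^ 2) : ℝ) -
      (μ m : ℝ) * (kappa d * ((M : ℝ) / (m : ℝ) ^ 2))| ≤
        2 * (σ 0 d : ℝ) * min (1 : ℝ) ((M : ℝ) / (m : ℝ) ^ 2) := by
    intro m hm
    have hm1 : 1 ≤ m := by
      rw [hA, Finset.mem_filter, Finset.mem_Icc] at hm; exact hm.1.1
    have hm0 : (0 : ℝ) < (m : ℝ) ^ 2 := by positivity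
    have hτ0 : (0 : ℝ) ≤ (σ 0 d : ℝ) := Nat.cast_nonneg _
    rw [← mul_sub, abs_mul]
    have hμ := LFunctions.abs_moebius_real_le_one m
    have hin : |(coprimeCount d (M / m ^ 2) : ℝ) - kappa d * ((M : ℝ) / (m : ℝ) ^ 2)| ≤
        2 * (σ 0 d : ℝ) * min (1 : ℝ) ((M : ℝ) / (m : ℝ) ^ 2) := by
      rcases le_or_gt (m ^ 2) M with hle | hlt
      · -- `m² ≤ M`: `min = 1`, Legendre twice
        have hmin : min (1 : ℝ) ((M : ℝ) / (m : ℝ) ^ 2) = 1 := by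
          refine min_eq_left ?_
          rw [le_div_iff₀ hm0, one_mul]
          exact_mod_cast hle
        rw [hmin, mul_one]
        have h1 := abs_coprimeCount_sub_le hd (M / m ^ 2)
        have h2 : |kappa d * ((M / m ^ 2 : ℕ) : ℝ) - kappa d * ((M : ℝ) / (m : ℝ) ^ 2)| ≤ σ 0 d := by
          rw [← mul_sub, abs_mul]
          have h3 := abs_natDiv_sub_div_le (pow_pos (by omega : 0 < m) 2) M
          push_cast at h3
          calc |kappa d| * |((M / m ^ 2 : ℕ) : ℝ) - (M : ℝ) / (m : ℝ) ^ 2| ≤ (σ 0 d : ℝ) * 1 :=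
                mul_le_mul (abs_kappa_le d) h3 (abs_nonneg _) hτ0
            _ = σ 0 d := mul_one _
        calc |(coprimeCount d (M / m ^ 2) : ℝ) - kappa d * ((M : ℝ) / (m : ℝ) ^ 2)|
            ≤ |(coprimeCount d (M / m ^ 2) : ℝ) - kappa d * ((M / m ^ 2 : ℕ) : ℝ)| +
              |kappa d * ((M / m ^ 2 : ℕ) : ℝ) - kappa d * ((M : ℝ) / (m : ℝ) ^ 2)| :=
              abs_sub_le _ _ _
          _ ≤ σ 0 d + σ 0 d := add_le_add h1 h2
          _ = 2 * (σ 0 d : ℝ) := by ring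
      · -- `m² > M`: the count vanishes
        have hdiv : M / m ^ 2 = 0 := Nat.div_eq_of_lt hlt
        have hmin : min (1 : ℝ) ((M : ℝ) / (m : ℝ) ^ 2) = (M : ℝ) / (m : ℝ) ^ 2 := by
          refine min_eq_right ?_
          rw [div_le_iff₀ hm0, one_mul]
          exact_mod_cast hlt.le
        rw [hdiv, coprimeCount_zero, Nat.cast_zero, zero_sub, abs_neg, hmin, abs_mul,
          abs_of_nonneg (by positivity : (0 : ℝ) ≤ (M : ℝ) / (m : ℝ) ^ 2)]
        calc |kappa d| * ((M : ℝ) / (m : ℝ) ^ 2) ≤ (σ 0 d : ℝ) * ((M : ℝ) / (m : ℝ) ^ 2) :=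
              mul_le_mul_of_nonneg_right (abs_kappa_le d) (by positivity)
          _ ≤ 2 * (σ 0 d : ℝ) * ((M : ℝ) / (m : ℝ) ^ 2) := by
              rw [mul_assoc]
              exact le_mul_of_one_le_left (by positivity) one_le_two
    calc |(μ m : ℝ)| * |(coprimeCount d (M / m ^ 2) : ℝ) - kappa d * ((M : ℝ) / (m : ℝ) ^ 2)|
        ≤ 1 * (2 * (σ 0 d : ℝ) * min (1 : ℝ) ((M : ℝ) / (m : ℝ) ^ 2)) :=
          mul_le_mul hμ hin (abs_nonneg _) zero_le_one
      _ = _ := one_mul _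
  have hAsub : A ⊆ Icc 1 T := Finset.filter_subset _ _
  calc |∑ m ∈ A, ((μ m : ℝ) * (coprimeCount d (M / m ^ 2) : ℝ) -
          (μ m : ℝ) * (kappa d * ((M : ℝ) / (m : ℝ) ^ 2)))|
      ≤ ∑ m ∈ A, |(μ m : ℝ) * (coprimeCount d (M / m ^ 2) : ℝ) -
          (μ m : ℝ) * (kappa d * ((M : ℝ) / (m : ℝ) ^ 2))| := Finset.abs_sum_le_sum_abs _ _
    _ ≤ ∑ m ∈ A, 2 * (σ 0 d : ℝ) * min (1 : ℝ) ((M : ℝ) / (m : ℝ) ^ 2) := Finset.sum_le_sum hterm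
    _ ≤ ∑ m ∈ Icc 1 T, 2 * (σ 0 d : ℝ) * min (1 : ℝ) ((M : ℝ) / (m : ℝ) ^ 2) :=
        Finset.sum_le_sum_of_subset_of_nonneg hAsub fun _ _ _ => by positivity
    _ = 2 * (σ 0 d : ℝ) * ∑ m ∈ Icc 1 T, min (1 : ℝ) ((M : ℝ) / (m : ℝ) ^ 2) :=
        (Finset.mul_sum _ _ _).symm
    _ ≤ 2 * (σ 0 d : ℝ) * (3 * Real.sqrt M) :=
        mul_le_mul_of_nonneg_left (sum_min_one_div_sq_le M T) (by positivity)
    _ = 6 * (σ 0 d : ℝ) * Real.sqrt M := by ring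


/-! ### Part 3. `A_d(N)` and `A(N)` for the squarefree numbers in terms of `F_d` -/

/-- For squarefree `d`: `#{n ∈ (0, N] : d ∣ n, n squarefree} = F_d(⌊N/d⌋)` (`n = dk` with `k`
squarefree and coprime to `d`). [folklore] -/
theorem card_filter_dvd_squarefree_eq {d : ℕ} (hd : Squarefree d) (N : ℕ) :
    ((Ioc 0 N).filter (fun n => d ∣ n ∧ Squarefree n)).card = sqfreeCoprimeCount d (N / d) := by
  unfold sqfreeCoprimeCount
  have hd0 : 0 < d := Nat.pos_of_ne_zero hd.ne_zero
  symm
  rw [← Finset.card_map ⟨fun k => d * k, mul_right_injective₀ hd0.ne'⟩]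
  congr 1
  ext n
  simp only [Finset.mem_map, Finset.mem_filter, Finset.mem_Ioc, Function.Embedding.coeFn_mk]
  constructor
  · rintro ⟨k, ⟨⟨hk0, hkN⟩, hksq, hkd⟩, rfl⟩
    refine ⟨⟨by positivity, ?_⟩, dvd_mul_right _ _, ?_⟩
    · calc d * k ≤ d * (N / d) := Nat.mul_le_mul_left _ hkN
        _ ≤ N := Nat.mul_div_le N d
    · exact Nat.squarefree_mul_iff.2 ⟨hkd.symm, hd, hksq⟩
  · rintro ⟨⟨hn0, hnN⟩, ⟨k, rfl⟩, hsq⟩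
    rw [Nat.squarefree_mul_iff] at hsq
    refine ⟨k, ⟨⟨Nat.pos_of_mul_pos_left hn0, ?_⟩, hsq.2.2, hsq.1.symm⟩, rfl⟩
    exact (Nat.le_div_iff_mul_le hd0).2 (by rw [mul_comm]; exact hnN)

/-- For squarefree `d`: `#{n ∈ (0, N] : n squarefree} = ∑_{e ∣ d} F_d(⌊N/e⌋)` (sort the squarefree
`n` by `e = (n, d)`; then `n = ek` with `k` squarefree and coprime to `d`). [folklore] -/
theorem card_filter_squarefree_eq_sum {d : ℕ} (hd : Squarefree d) (N : ℕ) :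
    ((Ioc 0 N).filter Squarefree).card = ∑ e ∈ d.divisors, sqfreeCoprimeCount d (N / e) := by
  have hd0 : d ≠ 0 := hd.ne_zero
  rw [Finset.card_eq_sum_card_fiberwise (f := fun n => Nat.gcd n d) (t := d.divisors)
    (fun n _ => Nat.mem_divisors.2 ⟨Nat.gcd_dvd_right n d, hd0⟩)]
  refine Finset.sum_congr rfl fun e he => ?_
  have he0 : 0 < e := Nat.pos_of_mem_divisors he
  obtain ⟨d', hdd'⟩ := Nat.dvd_of_mem_divisors he
  unfold sqfreeCoprimeCount
  symm
  rw [← Finset.card_map ⟨fun k => e * k, mul_right_injective₀ he0.ne'⟩]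
  congr 1
  ext n
  simp only [Finset.mem_map, Finset.mem_filter, Finset.mem_Ioc, Function.Embedding.coeFn_mk]
  constructor
  · rintro ⟨k, ⟨⟨hk0, hkN⟩, hksq, hkd⟩, rfl⟩
    rw [hdd'] at hkd
    refine ⟨⟨⟨by positivity, ?_⟩, ?_⟩, ?_⟩
    · calc e * k ≤ e * (N / e) := Nat.mul_le_mul_left _ hkN
        _ ≤ N := Nat.mul_div_le N e
    · have hesq : Squarefree e := hd.squarefree_of_dvd (Nat.dvd_of_mem_divisors he)
      exact Nat.squarefree_mul_iff.2
        ⟨(Nat.Coprime.coprime_mul_right_right hkd).symm, hesq, hksq⟩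
    · rw [hdd', Nat.gcd_mul_left, Nat.Coprime.gcd_eq_one (Nat.Coprime.coprime_mul_left_right hkd),
        mul_one]
  · rintro ⟨⟨⟨hn0, hnN⟩, hsq⟩, hgcd⟩
    have hen : e ∣ n := hgcd ▸ Nat.gcd_dvd_left n d
    obtain ⟨k, rfl⟩ := hen
    refine ⟨k, ⟨⟨Nat.pos_of_mul_pos_left hn0, ?_⟩, hsq.of_mul_right, ?_⟩, rfl⟩
    · exact (Nat.le_div_iff_mul_le he0).2 (by rw [mul_comm]; exact hnN)
    · refine Nat.coprime_of_dvd fun p hp hpk hpd => ?_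
      have hpe : p ∣ e := by
        rw [← hgcd]
        exact Nat.dvd_gcd (hpk.mul_left e) hpd
      have hpp : p * p ∣ e * k := mul_dvd_mul hpe hpk
      exact hp.ne_one (Nat.isUnit_iff.1 (hsq p hpp))

/-! ### Part 4. The density `g(d) = ∏_{p ∣ d} (p + 1)⁻¹` -/

/-- The density of the multiples of `d` among the squarefree numbers: the multiplicative function
`g(d) = ∏_{p ∣ d} 1/(p + 1)` (so `g(p) = 1/(p+1)`; only its values on squarefree `d` matter).
[folklore] -/
def dens : ArithmeticFunction ℝ :=
  ArithmeticFunction.prodPrimeFactors fun p => ((p : ℝ) + 1)⁻¹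

/-- `g(n) = ∏_{p ∣ n} (p + 1)⁻¹` for `n ≥ 1`. [folklore] -/
theorem dens_apply {n : ℕ} (hn : n ≠ 0) : dens n = ∏ p ∈ n.primeFactors, ((p : ℝ) + 1)⁻¹ :=
  ArithmeticFunction.prodPrimeFactors_apply hn

/-- `g(p) = 1/(p + 1)` at a prime. [folklore] -/
theorem dens_apply_prime {p : ℕ} (hp : p.Prime) : dens p = ((p : ℝ) + 1)⁻¹ := by
  rw [dens_apply hp.ne_zero, hp.primeFactors, Finset.prod_singleton]

/-- `g ≥ 0`. [folklore] -/
theorem dens_nonneg (n : ℕ) : 0 ≤ dens n := by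
  rcases eq_or_ne n 0 with rfl | hn
  · simp [dens]
  · rw [dens_apply hn]
    exact Finset.prod_nonneg fun p _ => by positivity

/-- `g(d) ≤ 1/d` for squarefree `d` (`∏ (p+1)⁻¹ ≤ ∏ p⁻¹ = d⁻¹`). [folklore] -/
theorem dens_le_inv {d : ℕ} (hd : Squarefree d) : dens d ≤ (d : ℝ)⁻¹ := by
  rw [dens_apply hd.ne_zero]
  calc ∏ p ∈ d.primeFactors, ((p : ℝ) + 1)⁻¹ ≤ ∏ p ∈ d.primeFactors, ((p : ℝ))⁻¹ := by
        refine Finset.prod_le_prod (fun p _ => by positivity) fun p hp => ?_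
        have hp0 : (0 : ℝ) < p := by exact_mod_cast (Nat.prime_of_mem_primeFactors hp).pos
        exact inv_anti₀ hp0 (by linarith)
    _ = (d : ℝ)⁻¹ := by
        rw [Finset.prod_inv_distrib, ← Nat.cast_prod, Nat.prod_primeFactors_of_squarefree hd]

/-- `g(d) τ(d) ≤ 1` for squarefree `d` (`g(d) ≤ 1/d` and `τ(d) ≤ d`). [folklore] -/
theorem dens_mul_sigma_zero_le_one {d : ℕ} (hd : Squarefree d) : dens d * (σ 0 d : ℝ) ≤ 1 := by
  have hd0 : (0 : ℝ) < d := by exact_mod_cast Nat.pos_of_ne_zero hd.ne_zero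
  have hτ : (σ 0 d : ℝ) ≤ d := by
    rw [ArithmeticFunction.sigma_zero_apply]
    exact_mod_cast Nat.card_divisors_le_self d
  calc dens d * (σ 0 d : ℝ) ≤ (d : ℝ)⁻¹ * d :=
        mul_le_mul (dens_le_inv hd) hτ (Nat.cast_nonneg _) (by positivity)
    _ = 1 := inv_mul_cancel₀ hd0.ne'

/-- `∑_{e ∣ d} f(e) = ∏_{p ∣ d} (1 + w(p))` for squarefree `d`, when `f(e) = ∏_{p ∣ e} w(p)` on the
(squarefree) divisors `e` of `d`. [folklore] -/
theorem sum_divisors_eq_prod_one_add {d : ℕ} (hd : Squarefree d) (w : ℕ → ℝ) {f : ℕ → ℝ}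
    (hf : ∀ e ∈ d.divisors, f e = ∏ p ∈ e.primeFactors, w p) :
    ∑ e ∈ d.divisors, f e = ∏ p ∈ d.primeFactors, (1 + w p) := by
  have hmult := ArithmeticFunction.IsMultiplicative.prodPrimeFactors (R := ℝ) w
  have key := hmult.prodPrimeFactors_one_add_of_squarefree hd
  calc ∑ e ∈ d.divisors, f e
      = ∑ e ∈ d.divisors, ArithmeticFunction.prodPrimeFactors w e := by
        refine Finset.sum_congr rfl fun e he => ?_
        rw [hf e he, ArithmeticFunction.prodPrimeFactors_apply (Nat.pos_of_mem_divisors he).ne']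
    _ = ∏ p ∈ d.primeFactors, (1 + ArithmeticFunction.prodPrimeFactors w p) := key.symm
    _ = ∏ p ∈ d.primeFactors, (1 + w p) := by
        refine Finset.prod_congr rfl fun p hp => ?_
        rw [ArithmeticFunction.prodPrimeFactors_apply (Nat.prime_of_mem_primeFactors hp).ne_zero,
          (Nat.prime_of_mem_primeFactors hp).primeFactors, Finset.prod_singleton]

/-- **`g(d) ∑_{e ∣ d} 1/e = 1/d`** for squarefree `d` (`g(d) σ(d) = d g(d) ∏ (1 + 1/p) = 1`): the
identity that makes `g` the density of the squarefree numbers in the progression `0 mod d`.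
[folklore] -/
theorem dens_mul_sum_divisors_inv {d : ℕ} (hd : Squarefree d) :
    dens d * ∑ e ∈ d.divisors, ((e : ℝ))⁻¹ = (d : ℝ)⁻¹ := by
  rw [sum_divisors_eq_prod_one_add hd (fun p => ((p : ℝ))⁻¹), dens_apply hd.ne_zero,
    ← Finset.prod_mul_distrib]
  · calc ∏ p ∈ d.primeFactors, ((p : ℝ) + 1)⁻¹ * (1 + ((p : ℝ))⁻¹)
          = ∏ p ∈ d.primeFactors, ((p : ℝ))⁻¹ := by
            refine Finset.prod_congr rfl fun p hp => ?_
            have hp0 : (0 : ℝ) < p := by exact_mod_cast (Nat.prime_of_mem_primeFactors hp).pos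
            field_simp
      _ = (d : ℝ)⁻¹ := by
          rw [Finset.prod_inv_distrib, ← Nat.cast_prod, Nat.prod_primeFactors_of_squarefree hd]
  · intro e he
    have hesq : Squarefree e := hd.squarefree_of_dvd (Nat.dvd_of_mem_divisors he)
    rw [Finset.prod_inv_distrib, ← Nat.cast_prod, Nat.prod_primeFactors_of_squarefree hesq]

/-- For squarefree `e`: `∏_{p ∣ e} (√p)⁻¹ = (√e)⁻¹`. [folklore] -/
theorem prod_primeFactors_inv_sqrt {e : ℕ} (he : Squarefree e) :
    ∏ p ∈ e.primeFactors, (Real.sqrt p)⁻¹ = (Real.sqrt e)⁻¹ := by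
  rw [Finset.prod_inv_distrib]
  congr 1
  have h0 : 0 ≤ ∏ p ∈ e.primeFactors, Real.sqrt p := Finset.prod_nonneg fun p _ => Real.sqrt_nonneg _
  have hsq : (∏ p ∈ e.primeFactors, Real.sqrt p) ^ 2 = (e : ℝ) := by
    rw [← Finset.prod_pow]
    rw [show (fun p : ℕ => Real.sqrt (p : ℝ) ^ 2) = fun p : ℕ => ((p : ℝ)) from
      funext fun p => Real.sq_sqrt (Nat.cast_nonneg p)]
    rw [← Nat.cast_prod, Nat.prod_primeFactors_of_squarefree he]
  rw [← hsq, Real.sqrt_sq h0]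

/-- **`g(d) ∑_{e ∣ d} 1/√e ≤ 1/√d`** for squarefree `d` (termwise `(1 + p^{-1/2})/(p+1) ≤ p^{-1/2}`).
[folklore] -/
theorem dens_mul_sum_divisors_inv_sqrt_le {d : ℕ} (hd : Squarefree d) :
    dens d * ∑ e ∈ d.divisors, (Real.sqrt e)⁻¹ ≤ (Real.sqrt d)⁻¹ := by
  rw [sum_divisors_eq_prod_one_add hd (fun p => (Real.sqrt p)⁻¹), dens_apply hd.ne_zero,
    ← Finset.prod_mul_distrib, ← prod_primeFactors_inv_sqrt hd]
  · refine Finset.prod_le_prod (fun p _ => by positivity) fun p hp => ?_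
    have hp1 : (1 : ℝ) ≤ p := by exact_mod_cast (Nat.prime_of_mem_primeFactors hp).one_le
    have hs0 : 0 < Real.sqrt p := Real.sqrt_pos.2 (by linarith)
    have hs1 : Real.sqrt p ≤ p := by
      rw [Real.sqrt_le_left (by linarith)]
      nlinarith
    have h1 : (1 + (Real.sqrt p)⁻¹) = (Real.sqrt p + 1) * (Real.sqrt p)⁻¹ := by
      field_simp
    rw [h1, ← mul_assoc]
    calc ((p : ℝ) + 1)⁻¹ * (Real.sqrt p + 1) * (Real.sqrt p)⁻¹ ≤ 1 * (Real.sqrt p)⁻¹ := by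
          refine mul_le_mul_of_nonneg_right ?_ (by positivity)
          rw [inv_mul_le_iff₀ (by linarith : (0 : ℝ) < p + 1), mul_one]
          linarith
      _ = (Real.sqrt p)⁻¹ := one_mul _
  · intro e he
    exact (prod_primeFactors_inv_sqrt (hd.squarefree_of_dvd (Nat.dvd_of_mem_divisors he))).symm

/-! ### Part 5. The level of distribution of the squarefree numbers (pointwise in `d`) -/

/-- **The remainder of the squarefree numbers in the progression `0 mod d`**: for squarefree `d`
and every `N`,
`|#{n ≤ N : d ∣ n, n sqf} - g(d) #{n ≤ N : n sqf}| ≤ 4 τ(d) + 12 τ(d) √(N/d)`. [folklore] -/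
theorem abs_card_dvd_sub_dens_mul_card_le {d : ℕ} (hd : Squarefree d) (N : ℕ) :
    |(((Ioc 0 N).filter (fun n => d ∣ n ∧ Squarefree n)).card : ℝ) -
        dens d * (((Ioc 0 N).filter Squarefree).card : ℝ)| ≤
      4 * (σ 0 d : ℝ) + 12 * (σ 0 d : ℝ) * Real.sqrt ((N : ℝ) / d) := by
  have hd0 : d ≠ 0 := hd.ne_zero
  have hd0' : (0 : ℝ) < d := by exact_mod_cast Nat.pos_of_ne_zero hd0
  rw [card_filter_dvd_squarefree_eq hd, card_filter_squarefree_eq_sum hd, Nat.cast_sum]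
  set τ : ℝ := (σ 0 d : ℝ) with hτ
  set α : ℝ := alpha d N with hα
  set g : ℝ := dens d with hg
  set F : ℕ → ℝ := fun e => (sqfreeCoprimeCount d (N / e) : ℝ) with hF
  set u : ℕ → ℝ := fun e => ((N / e : ℕ) : ℝ) with hu
  have hτ0 : 0 ≤ τ := Nat.cast_nonneg _
  have hg0 : 0 ≤ g := dens_nonneg d
  have hα' : |α| ≤ 2 * τ := abs_alpha_le d N
  -- the estimate for each `F_d(⌊N/e⌋)`
  have hFe : ∀ e ∈ d.divisors, |F e - α * u e| ≤ 6 * τ * Real.sqrt ((N : ℝ) / e) := by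
    intro e he
    have he0 : (0 : ℝ) < e := by exact_mod_cast Nat.pos_of_mem_divisors he
    have h := abs_sqfreeCoprimeCount_sub_le (M := N / e) (T := N) hd0 (Nat.div_le_self N e)
    refine h.trans (mul_le_mul_of_nonneg_left (Real.sqrt_le_sqrt Nat.cast_div_le) (by positivity))
  have hdmem : d ∈ d.divisors := Nat.mem_divisors_self d hd0
  -- decomposition
  have hdecomp : F d - g * ∑ e ∈ d.divisors, F e =
      (F d - α * u d) + α * (u d - g * ∑ e ∈ d.divisors, u e) +
        g * ∑ e ∈ d.divisors, (α * u e - F e) := by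
    rw [Finset.sum_sub_distrib, ← Finset.mul_sum]
    ring
  -- (ii) the floor bracket
  have hbr : |u d - g * ∑ e ∈ d.divisors, u e| ≤ 2 := by
    have hmain : (N : ℝ) / d - g * ∑ e ∈ d.divisors, (N : ℝ) / e = 0 := by
      have : ∑ e ∈ d.divisors, (N : ℝ) / e = (N : ℝ) * ∑ e ∈ d.divisors, ((e : ℝ))⁻¹ := by
        rw [Finset.mul_sum]
        exact Finset.sum_congr rfl fun e _ => div_eq_mul_inv _ _
      rw [this, mul_left_comm, dens_mul_sum_divisors_inv hd, div_eq_mul_inv, sub_self]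
    have hsplit : u d - g * ∑ e ∈ d.divisors, u e =
        (u d - (N : ℝ) / d) - g * ∑ e ∈ d.divisors, (u e - (N : ℝ) / e) +
          ((N : ℝ) / d - g * ∑ e ∈ d.divisors, (N : ℝ) / e) := by
      rw [Finset.sum_sub_distrib]
      ring
    rw [hsplit, hmain, add_zero]
    have h1 : |u d - (N : ℝ) / d| ≤ 1 := abs_natDiv_sub_div_le (Nat.pos_of_ne_zero hd0) N
    have h2 : |g * ∑ e ∈ d.divisors, (u e - (N : ℝ) / e)| ≤ 1 := by
      rw [abs_mul, abs_of_nonneg hg0]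
      calc g * |∑ e ∈ d.divisors, (u e - (N : ℝ) / e)| ≤ g * τ := by
            refine mul_le_mul_of_nonneg_left ?_ hg0
            refine (Finset.abs_sum_le_sum_abs _ _).trans ?_
            calc ∑ e ∈ d.divisors, |u e - (N : ℝ) / e| ≤ ∑ e ∈ d.divisors, (1 : ℝ) :=
                  Finset.sum_le_sum fun e he => abs_natDiv_sub_div_le (Nat.pos_of_mem_divisors he) N
              _ = τ := by simp [hτ, ArithmeticFunction.sigma_zero_apply]
        _ ≤ 1 := dens_mul_sigma_zero_le_one hd
    calc |u d - (N : ℝ) / d - g * ∑ e ∈ d.divisors, (u e - (N : ℝ) / e)|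
        ≤ |u d - (N : ℝ) / d| + |g * ∑ e ∈ d.divisors, (u e - (N : ℝ) / e)| := abs_sub _ _
      _ ≤ 1 + 1 := add_le_add h1 h2
      _ = 2 := by norm_num
  -- (iii) the averaged error terms
  have hiii : |g * ∑ e ∈ d.divisors, (α * u e - F e)| ≤ 6 * τ * Real.sqrt ((N : ℝ) / d) := by
    rw [abs_mul, abs_of_nonneg hg0]
    calc g * |∑ e ∈ d.divisors, (α * u e - F e)|
        ≤ g * ∑ e ∈ d.divisors, 6 * τ * Real.sqrt ((N : ℝ) / e) := by
          refine mul_le_mul_of_nonneg_left ((Finset.abs_sum_le_sum_abs _ _).trans ?_) hg0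
          exact Finset.sum_le_sum fun e he => (abs_sub_comm _ _).trans_le (hFe e he)
      _ = 6 * τ * Real.sqrt N * (g * ∑ e ∈ d.divisors, (Real.sqrt e)⁻¹) := by
          rw [Finset.mul_sum, Finset.mul_sum, Finset.mul_sum]
          refine Finset.sum_congr rfl fun e _ => ?_
          rw [Real.sqrt_div (Nat.cast_nonneg _)]
          ring
      _ ≤ 6 * τ * Real.sqrt N * (Real.sqrt d)⁻¹ :=
          mul_le_mul_of_nonneg_left (dens_mul_sum_divisors_inv_sqrt_le hd) (by positivity)
      _ = 6 * τ * Real.sqrt ((N : ℝ) / d) := by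
          rw [Real.sqrt_div (Nat.cast_nonneg _)]
          ring
  -- (i) the main error term
  have hi : |F d - α * u d| ≤ 6 * τ * Real.sqrt ((N : ℝ) / d) := hFe d hdmem
  have hii : |α * (u d - g * ∑ e ∈ d.divisors, u e)| ≤ 4 * τ := by
    rw [abs_mul]
    calc |α| * |u d - g * ∑ e ∈ d.divisors, u e| ≤ 2 * τ * 2 :=
          mul_le_mul hα' hbr (abs_nonneg _) (by positivity)
      _ = 4 * τ := by ring
  change |F d - g * ∑ e ∈ d.divisors, F e| ≤ 4 * τ + 12 * τ * Real.sqrt ((N : ℝ) / d)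
  rw [hdecomp]
  calc |F d - α * u d + α * (u d - g * ∑ e ∈ d.divisors, u e) +
          g * ∑ e ∈ d.divisors, (α * u e - F e)|
      ≤ |F d - α * u d| + |α * (u d - g * ∑ e ∈ d.divisors, u e)| +
          |g * ∑ e ∈ d.divisors, (α * u e - F e)| := abs_add_three _ _ _
    _ ≤ 6 * τ * Real.sqrt ((N : ℝ) / d) + 4 * τ + 6 * τ * Real.sqrt ((N : ℝ) / d) :=
        add_le_add (add_le_add hi hii) hiii
    _ = 4 * τ + 12 * τ * Real.sqrt ((N : ℝ) / d) := by ring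


/-! ### Part 6. A positive proportion of the integers is squarefree -/

/-- `#{n ≤ N : n not squarefree} ≤ (3/4) N`: such `n` is divisible by some `m²` with `2 ≤ m ≤ N`,
and `∑_{m ≥ 2} 1/m² ≤ 1/4 + 1/2`. [folklore] -/
theorem card_filter_not_squarefree_le (N : ℕ) :
    (((Ioc 0 N).filter (fun n => ¬Squarefree n)).card : ℝ) ≤ 3 / 4 * N := by
  have hsub : (Ioc 0 N).filter (fun n => ¬Squarefree n) ⊆
      (Icc 2 N).biUnion (fun m => (Ioc 0 N).filter (fun n => m ^ 2 ∣ n)) := by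
    intro n hn
    rw [Finset.mem_filter, Finset.mem_Ioc] at hn
    obtain ⟨⟨hn0, hnN⟩, hns⟩ := hn
    rw [Finset.mem_biUnion]
    have hex : ∃ m : ℕ, m * m ∣ n ∧ ¬IsUnit m := by
      by_contra hcon
      push Not at hcon
      exact hns fun m hm => hcon m hm
    obtain ⟨m, hmn, hmu⟩ := hex
    rw [Nat.isUnit_iff] at hmu
    have hm0 : m ≠ 0 := by
      rintro rfl
      rw [zero_mul, zero_dvd_iff] at hmn
      omega
    have hm2 : 2 ≤ m := by omega
    have hmleN : m ≤ N := (Nat.le_of_dvd hn0 ((dvd_mul_right m m).trans hmn)).trans hnN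
    refine ⟨m, Finset.mem_Icc.2 ⟨hm2, hmleN⟩, ?_⟩
    rw [Finset.mem_filter, Finset.mem_Ioc]
    exact ⟨⟨hn0, hnN⟩, by rw [sq]; exact hmn⟩
  calc (((Ioc 0 N).filter (fun n => ¬Squarefree n)).card : ℝ)
      ≤ (((Icc 2 N).biUnion (fun m => (Ioc 0 N).filter (fun n => m ^ 2 ∣ n))).card : ℝ) := by
        exact_mod_cast Finset.card_le_card hsub
    _ ≤ ∑ m ∈ Icc 2 N, ((((Ioc 0 N).filter (fun n => m ^ 2 ∣ n)).card : ℕ) : ℝ) := by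
        exact_mod_cast Finset.card_biUnion_le
    _ = ∑ m ∈ Icc 2 N, ((N / m ^ 2 : ℕ) : ℝ) := by
        refine Finset.sum_congr rfl fun m _ => ?_
        rw [Nat.Ioc_filter_dvd_card_eq_div]
    _ ≤ ∑ m ∈ Icc 2 N, (N : ℝ) / (m : ℝ) ^ 2 := by
        refine Finset.sum_le_sum fun m _ => ?_
        have h : ((N / m ^ 2 : ℕ) : ℝ) ≤ (N : ℝ) / ((m ^ 2 : ℕ) : ℝ) := Nat.cast_div_le
        push_cast at h
        exact h
    _ = (N : ℝ) * ∑ m ∈ Icc 2 N, (1 : ℝ) / (m : ℝ) ^ 2 := by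
        rw [Finset.mul_sum]
        exact Finset.sum_congr rfl fun m _ => by ring
    _ ≤ (N : ℝ) * (3 / 4) := by
        refine mul_le_mul_of_nonneg_left ?_ (Nat.cast_nonneg _)
        rcases lt_or_ge N 2 with hN | hN
        · rw [Finset.Icc_eq_empty (by omega), Finset.sum_empty]
          norm_num
        · rw [show Icc 2 N = insert 2 (Ioc 2 N) by
              ext m; simp only [Finset.mem_Icc, Finset.mem_insert, Finset.mem_Ioc]; omega,
            Finset.sum_insert (by simp)]
          have h := LFunctions.sum_Ioc_one_div_sq_le (D := 2) (N := N) (by norm_num)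
          push_cast at h ⊢
          norm_num at h ⊢
          linarith
    _ = 3 / 4 * N := by ring

/-- **`#{n ≤ N : n squarefree} ≥ N/4`**. [folklore] -/
theorem card_filter_squarefree_ge (N : ℕ) :
    (N : ℝ) / 4 ≤ (((Ioc 0 N).filter Squarefree).card : ℝ) := by
  have h := Finset.card_filter_add_card_filter_not (s := Ioc 0 N) (p := Squarefree)
  rw [Nat.card_Ioc, Nat.sub_zero] at h
  have h' : (((Ioc 0 N).filter Squarefree).card : ℝ) +
      (((Ioc 0 N).filter (fun n => ¬Squarefree n)).card : ℝ) = N := by exact_mod_cast h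
  have h2 := card_filter_not_squarefree_le N
  linarith

/-! ### Part 7. The sifted sequence of squarefree numbers and the easy hypotheses -/

/-- **The witness sequence**: `a_n = μ²(n)` (the indicator of the squarefree numbers), with
`A(x) = ∑_{n ≤ x} a_n = #{n ≤ x squarefree}` as its size function and the multiplicative density
`g(d) = ∏_{p ∣ d} (p + 1)⁻¹`. [folklore] -/
def sqfreeSeq : SieveSequence where
  a := LFunctions.sqfreeInd
  a_nonneg := LFunctions.sqfreeInd_nonneg
  size x := ∑ n ∈ (Ioc 0 ⌊x⌋₊).filter (fun n => 1 ∣ n), LFunctions.sqfreeInd n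
  density := dens
  density_mult := ArithmeticFunction.IsMultiplicative.prodPrimeFactors _

/-- The size of `sqfreeSeq` is its own counting function (FI (1.3)), by definition. [folklore] -/
theorem sqfreeSeq_size (x : ℝ) : sqfreeSeq.size x = sqfreeSeq.congrSum 1 x := rfl

/-- `A_d(x) = #{n ≤ x : d ∣ n, n squarefree}` for `sqfreeSeq`. [folklore] -/
theorem sqfreeSeq_congrSum (d : ℕ) (x : ℝ) :
    sqfreeSeq.congrSum d x = (((Ioc 0 ⌊x⌋₊).filter (fun n => d ∣ n ∧ Squarefree n)).card : ℝ) := by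
  rw [SieveSequence.congrSum]
  change ∑ n ∈ (Ioc 0 ⌊x⌋₊).filter (fun n => d ∣ n), LFunctions.sqfreeInd n = _
  rw [show ((Ioc 0 ⌊x⌋₊).filter fun n => d ∣ n ∧ Squarefree n) =
      ((Ioc 0 ⌊x⌋₊).filter (fun n => d ∣ n)).filter Squarefree by rw [Finset.filter_filter],
    Finset.card_filter, Nat.cast_sum]
  refine Finset.sum_congr rfl fun n _ => ?_
  unfold LFunctions.sqfreeInd
  split_ifs <;> simp

/-- `A(x) = #{n ≤ x : n squarefree}` for `sqfreeSeq`. [folklore] -/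
theorem sqfreeSeq_size_eq (x : ℝ) :
    sqfreeSeq.size x = (((Ioc 0 ⌊x⌋₊).filter Squarefree).card : ℝ) := by
  rw [sqfreeSeq_size, sqfreeSeq_congrSum,
    show ((Ioc 0 ⌊x⌋₊).filter fun n => 1 ∣ n ∧ Squarefree n) = (Ioc 0 ⌊x⌋₊).filter Squarefree from
      Finset.filter_congr fun n _ => by simp only [one_dvd, true_and]]

/-- `A(x) ≥ 0`. [folklore] -/
theorem sqfreeSeq_size_nonneg (x : ℝ) : 0 ≤ sqfreeSeq.size x := by
  rw [sqfreeSeq_size_eq]; positivity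

/-- `A(x) ≤ x` for `x ≥ 0`. [folklore] -/
theorem sqfreeSeq_size_le {x : ℝ} (hx : 0 ≤ x) : sqfreeSeq.size x ≤ x := by
  rw [sqfreeSeq_size_eq]
  calc (((Ioc 0 ⌊x⌋₊).filter Squarefree).card : ℝ) ≤ ((Ioc 0 ⌊x⌋₊).card : ℝ) := by
        exact_mod_cast Finset.card_filter_le _ _
    _ = ⌊x⌋₊ := by rw [Nat.card_Ioc, Nat.sub_zero]
    _ ≤ x := Nat.floor_le hx

/-- `A(x) ≥ x/8` for `x ≥ 2`. [folklore] -/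
theorem sqfreeSeq_size_ge {x : ℝ} (hx : 2 ≤ x) : x / 8 ≤ sqfreeSeq.size x := by
  rw [sqfreeSeq_size_eq]
  have h := card_filter_squarefree_ge ⌊x⌋₊
  have hfl : x - 1 ≤ (⌊x⌋₊ : ℝ) := by
    have := Nat.lt_floor_add_one x
    linarith
  linarith

/-- The level `D(x) = x^{3/4}` of the counterexample. [folklore] -/
def levelFn (x : ℝ) : ℝ := x ^ (3 / 4 : ℝ)

/-- The parameter `δ(x) = 2√x` of the counterexample (it makes the range (B1) empty). [folklore] -/
def deltaFn (x : ℝ) : ℝ := 2 * Real.sqrt x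

/-- The parameter `Δ(x) = exp(x³)` of the counterexample (it makes `log δ / log Δ → 0` fast). [folklore] -/
def bigDeltaFn (x : ℝ) : ℝ := Real.exp (x ^ 3)

/-- Hypothesis (1.4) for `sqfreeSeq`: `A(x) ≥ (1/8) A(√x) (log x)²` for large `x`. [folklore] -/
theorem clause_14 : ∃ c : ℝ, 0 < c ∧ ∀ᶠ x : ℝ in atTop,
    c * sqfreeSeq.size (Real.sqrt x) * Real.log x ^ 2 ≤ sqfreeSeq.size x := by
  refine ⟨1 / 8, by norm_num, ?_⟩
  have hlo := (isLittleO_log_rpow_rpow_atTop (s := 1 / 2) 2 (by norm_num)).eventuallyLE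
  filter_upwards [hlo, eventually_ge_atTop (2 : ℝ)] with x hx hx2
  have hx0 : 0 ≤ x := by linarith
  have hl0 : 0 ≤ Real.log x := Real.log_nonneg (by linarith)
  have hlog : Real.log x ^ 2 ≤ Real.sqrt x := by
    have h1 : ‖Real.log x ^ (2 : ℝ)‖ ≤ ‖x ^ (1 / 2 : ℝ)‖ := hx
    rw [Real.norm_of_nonneg (Real.rpow_nonneg hl0 _), Real.norm_of_nonneg (Real.rpow_nonneg hx0 _),
      ← Real.sqrt_eq_rpow, Real.rpow_two] at h1
    exact h1
  have hs : sqfreeSeq.size (Real.sqrt x) ≤ Real.sqrt x := sqfreeSeq_size_le (Real.sqrt_nonneg x)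
  have hS : x / 8 ≤ sqfreeSeq.size x := sqfreeSeq_size_ge hx2
  have hsn : 0 ≤ sqfreeSeq.size (Real.sqrt x) := sqfreeSeq_size_nonneg _
  calc 1 / 8 * sqfreeSeq.size (Real.sqrt x) * Real.log x ^ 2
      ≤ 1 / 8 * Real.sqrt x * Real.sqrt x := by gcongr
    _ = x / 8 := by rw [mul_assoc, Real.mul_self_sqrt hx0]; ring
    _ ≤ sqfreeSeq.size x := hS

/-- Hypothesis (1.6) for `sqfreeSeq` (with `K = 8`): `A_d(x) ≤ x/d ≤ 8 A(x)/d`. [folklore] -/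
theorem clause_16 : ∃ K : ℝ, ∀ᶠ x : ℝ in atTop, ∀ d : ℕ, 1 ≤ d → (d : ℝ) ≤ x ^ (1 / 3 : ℝ) →
    sqfreeSeq.congrSum d x ≤ K * (σ 0 d : ℝ) ^ 8 / d * sqfreeSeq.size x := by
  refine ⟨8, ?_⟩
  filter_upwards [eventually_ge_atTop (2 : ℝ)] with x hx d hd _
  have hx0 : 0 ≤ x := by linarith
  have hd0 : (0 : ℝ) < d := by exact_mod_cast hd
  have h1 : sqfreeSeq.congrSum d x ≤ x / d := by
    rw [sqfreeSeq_congrSum]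
    calc (((Ioc 0 ⌊x⌋₊).filter (fun n => d ∣ n ∧ Squarefree n)).card : ℝ)
        ≤ (((Ioc 0 ⌊x⌋₊).filter (fun n => d ∣ n)).card : ℝ) := by
          exact_mod_cast Finset.card_le_card fun n hn => by
            rw [Finset.mem_filter] at hn ⊢
            exact ⟨hn.1, hn.2.1⟩
      _ = ((⌊x⌋₊ / d : ℕ) : ℝ) := by rw [Nat.Ioc_filter_dvd_card_eq_div]
      _ ≤ (⌊x⌋₊ : ℝ) / d := Nat.cast_div_le
      _ ≤ x / d := by gcongr; exact Nat.floor_le hx0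
  have h2 : x / 8 ≤ sqfreeSeq.size x := sqfreeSeq_size_ge hx
  have hτ : (1 : ℝ) ≤ (σ 0 d : ℝ) ^ 8 :=
    one_le_pow₀ (by exact_mod_cast one_le_sigma_zero (by omega : d ≠ 0))
  calc sqfreeSeq.congrSum d x ≤ x / d := h1
    _ = 8 * 1 / d * (x / 8) := by field_simp
    _ ≤ 8 * (σ 0 d : ℝ) ^ 8 / d * sqfreeSeq.size x := by gcongr

/-- Hypothesis (1.8) for `sqfreeSeq` (with `K = 1`): `0 ≤ 1/(p+1) < 1`, `1/(p+1) ≤ 1/p`. [folklore] -/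
theorem clause_18 : ∃ K : ℝ, ∀ p : ℕ, p.Prime →
    0 ≤ sqfreeSeq.density p ∧ sqfreeSeq.density p < 1 ∧ sqfreeSeq.density p ≤ K / p := by
  refine ⟨1, fun p hp => ?_⟩
  change 0 ≤ dens p ∧ dens p < 1 ∧ dens p ≤ 1 / p
  rw [dens_apply_prime hp]
  have hp2 : (2 : ℝ) ≤ p := by exact_mod_cast hp.two_le
  refine ⟨by positivity, inv_lt_one_of_one_lt₀ (by linarith), ?_⟩
  rw [one_div]
  exact inv_anti₀ (by linarith) (by linarith)

/-- Hypothesis (R1) for the parameters `D = x^{3/4}`, `δ = 2√x`, `Δ = exp(x³)`. [folklore] -/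
theorem clause_R1 : ∀ᶠ x : ℝ in atTop,
    x ^ (2 / 3 : ℝ) < levelFn x ∧ levelFn x < x ∧ 2 ≤ deltaFn x ∧ 2 ≤ bigDeltaFn x := by
  filter_upwards [eventually_gt_atTop (1 : ℝ)] with x hx
  refine ⟨Real.rpow_lt_rpow_of_exponent_lt hx (by norm_num), ?_, ?_, ?_⟩
  · unfold levelFn
    conv_rhs => rw [← Real.rpow_one x]
    exact Real.rpow_lt_rpow_of_exponent_lt hx (by norm_num)
  · unfold deltaFn
    have := Real.one_le_sqrt.2 hx.le
    linarith
  · unfold bigDeltaFn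
    have h1 : (1 : ℝ) ≤ x ^ 3 := one_le_pow₀ hx.le
    have h2 := Real.add_one_le_exp (x ^ 3)
    linarith

/-- Hypothesis (B) is VACUOUS for `δ = 2√x`: the range (B1) `√D/Δ < N < √x/δ = 1/2` forces the
dyadic interval `(N, 2N]` to contain no integer, so the bilinear form is an empty sum. [folklore] -/
theorem clause_B : ∀ᶠ x : ℝ in atTop, ∀ N : ℝ, Real.sqrt (levelFn x) / bigDeltaFn x < N →
    N < Real.sqrt x / deltaFn x → ∀ C : ℝ, 1 ≤ C → C ≤ x / levelFn x →
      sqfreeSeq.fiBilinear x N C ≤ sqfreeSeq.size x / Real.log x ^ SieveSequence.fiLogSaving := by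
  filter_upwards [eventually_gt_atTop (1 : ℝ)] with x hx N _ hN C _ _
  have hx0 : 0 < x := by linarith
  have hhalf : Real.sqrt x / deltaFn x = 1 / 2 := by
    unfold deltaFn
    have hs : 0 < Real.sqrt x := Real.sqrt_pos.2 hx0
    field_simp
  have hN2 : N < 1 / 2 := hhalf ▸ hN
  have hempty : Ioc ⌊N⌋₊ ⌊2 * N⌋₊ = ∅ := by
    rw [Nat.floor_eq_zero.2 (by linarith : 2 * N < 1)]
    exact Finset.Ioc_eq_empty (by omega)
  have hB0 : sqfreeSeq.fiBilinear x N C = 0 := by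
    rw [SieveSequence.fiBilinear]
    refine Finset.sum_eq_zero fun m _ => ?_
    rw [hempty, Finset.filter_empty, Finset.sum_empty, abs_zero]
  rw [hB0]
  exact div_nonneg (sqfreeSeq_size_nonneg x) (pow_nonneg (Real.log_nonneg hx.le) _)

/-! ### Part 8. Hypothesis (1.9): Mertens' theorem with the prime number theorem error term -/

/-- `t(n) = ∑_{p ≤ n} 1/(p(p+1))`, the convergent correction from `1/p` to `1/(p+1)`. [folklore] -/
def primeCorr (n : ℕ) : ℝ := ∑ p ∈ Nat.primesLE n, ((p : ℝ) * ((p : ℝ) + 1))⁻¹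

/-- `t` is nondecreasing. [folklore] -/
theorem primeCorr_mono : Monotone primeCorr := fun _ _ h =>
  Finset.sum_le_sum_of_subset_of_nonneg (Nat.primesLE_mono h) fun _ _ _ => by positivity

/-- The tail of `t`: `t(m) - t(n) ≤ 1/n` for `1 ≤ n ≤ m`. [folklore] -/
theorem primeCorr_sub_le {n m : ℕ} (hn : 1 ≤ n) (hnm : n ≤ m) :
    primeCorr m - primeCorr n ≤ 1 / n := by
  unfold primeCorr
  rw [← Finset.sum_sdiff_eq_sub (Nat.primesLE_mono hnm)]
  calc ∑ p ∈ Nat.primesLE m \ Nat.primesLE n, ((p : ℝ) * ((p : ℝ) + 1))⁻¹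
      ≤ ∑ p ∈ Nat.primesLE m \ Nat.primesLE n, (1 : ℝ) / (p : ℝ) ^ 2 := by
        refine Finset.sum_le_sum fun p hp => ?_
        rw [Finset.mem_sdiff] at hp
        have hp0 : (0 : ℝ) < p := by exact_mod_cast (Nat.prime_of_mem_primesLE hp.1).pos
        rw [one_div]
        exact inv_anti₀ (by positivity) (by nlinarith)
    _ ≤ ∑ k ∈ Ioc n m, (1 : ℝ) / (k : ℝ) ^ 2 := by
        refine Finset.sum_le_sum_of_subset_of_nonneg ?_ fun _ _ _ => by positivity
        intro p hp
        rw [Finset.mem_sdiff, Nat.mem_primesLE, Nat.mem_primesLE] at hp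
        rw [Finset.mem_Ioc]
        refine ⟨?_, hp.1.1⟩
        by_contra h
        exact hp.2 ⟨by omega, hp.1.2⟩
    _ ≤ 1 / n := LFunctions.sum_Ioc_one_div_sq_le hn

/-- `t(n) ≤ 1`. [folklore] -/
theorem primeCorr_le_one (n : ℕ) : primeCorr n ≤ 1 := by
  have h1 : primeCorr 1 = 0 := by simp [primeCorr]
  rcases Nat.eq_zero_or_pos n with rfl | hn
  · simp [primeCorr]
  · have := primeCorr_sub_le le_rfl hn
    rw [h1, Nat.cast_one] at this
    linarith

/-- **Hypothesis (1.9) for `g(p) = 1/(p+1)`**: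
`∑_{p ≤ y} 1/(p+1) = log log y + c + O((log y)^{-10})` for `y ≥ 2`, from the tree's PROVED Mertens
theorem with the de la Vallée Poussin error term (`Literature.NumberTheory.LFunctions.Mertens.exists_sum_primesLE_inv_loglog`) and
`1/(p+1) = 1/p - 1/(p(p+1))`. [folklore] -/
theorem clause_19 : ∃ c K : ℝ, ∀ y : ℝ, 2 ≤ y →
    |(∑ p ∈ Nat.primesLE ⌊y⌋₊, sqfreeSeq.density p) - (Real.log (Real.log y) + c)| ≤
      K / Real.log y ^ 10 := by
  obtain ⟨c₀, K₀, h₀⟩ := LFunctions.Mertens.exists_sum_primesLE_inv_loglog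
  have hbdd : BddAbove (Set.range primeCorr) :=
    ⟨1, by rintro _ ⟨n, rfl⟩; exact primeCorr_le_one n⟩
  set T : ℝ := ⨆ n : ℕ, primeCorr n with hT
  have hTge : ∀ n, primeCorr n ≤ T := fun n => le_ciSup hbdd n
  have hTle : ∀ n : ℕ, 1 ≤ n → T ≤ primeCorr n + 1 / n := fun n hn => by
    refine ciSup_le fun m => ?_
    rcases le_total n m with hnm | hmn
    · linarith [primeCorr_sub_le hn hnm]
    · have h1 := primeCorr_mono hmn
      have h2 : (0 : ℝ) ≤ 1 / n := by positivity
      linarith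
  refine ⟨c₀ - T, K₀ + 2 * 10 ^ 10, fun y hy => ?_⟩
  have hy0 : 0 < y := by linarith
  have hl0 : 0 < Real.log y := Real.log_pos (by linarith)
  set n : ℕ := ⌊y⌋₊ with hn
  have hn2 : 2 ≤ n := Nat.le_floor (by exact_mod_cast hy)
  have hsum : ∑ p ∈ Nat.primesLE n, sqfreeSeq.density p =
      (∑ p ∈ Nat.primesLE n, ((p : ℝ))⁻¹) - primeCorr n := by
    unfold primeCorr
    rw [← Finset.sum_sub_distrib]
    refine Finset.sum_congr rfl fun p hp => ?_
    have hpp := Nat.prime_of_mem_primesLE hp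
    have hp0 : (0 : ℝ) < p := by exact_mod_cast hpp.pos
    change dens p = _
    rw [dens_apply_prime hpp]
    field_simp
    ring
  have htail : |T - primeCorr n| ≤ 2 / y := by
    rw [abs_of_nonneg (by linarith [hTge n])]
    have h1 := hTle n (by omega)
    have hny : y - 1 ≤ n := by
      have := Nat.lt_floor_add_one y
      linarith
    have hn0 : (0 : ℝ) < n := by exact_mod_cast (by omega : 0 < n)
    have h2 : 1 / (n : ℝ) ≤ 2 / y := by
      rw [div_le_div_iff₀ hn0 hy0]
      linarith
    linarith
  have hlog : 2 / y ≤ 2 * 10 ^ 10 / Real.log y ^ 10 := by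
    have hl := Real.log_le_rpow_div hy0.le (by norm_num : (0 : ℝ) < 1 / 10)
    have hl' : Real.log y ≤ 10 * y ^ (1 / 10 : ℝ) := by
      rw [div_eq_mul_inv, show ((1 : ℝ) / 10)⁻¹ = 10 by norm_num] at hl
      linarith
    have hpow : Real.log y ^ 10 ≤ 10 ^ 10 * y := by
      calc Real.log y ^ 10 ≤ (10 * y ^ (1 / 10 : ℝ)) ^ 10 := pow_le_pow_left₀ hl0.le hl' 10
        _ = 10 ^ 10 * y := by
            rw [mul_pow, ← Real.rpow_natCast (y ^ (1 / 10 : ℝ)) 10, ← Real.rpow_mul hy0.le]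
            norm_num
    rw [div_le_div_iff₀ hy0 (pow_pos hl0 10)]
    linarith
  calc |(∑ p ∈ Nat.primesLE n, sqfreeSeq.density p) - (Real.log (Real.log y) + (c₀ - T))|
      = |((∑ p ∈ Nat.primesLE n, ((p : ℝ))⁻¹) - (Real.log (Real.log y) + c₀)) +
          (T - primeCorr n)| := by
        rw [hsum]; ring_nf
    _ ≤ |(∑ p ∈ Nat.primesLE n, ((p : ℝ))⁻¹) - (Real.log (Real.log y) + c₀)| +
          |T - primeCorr n| := abs_add_le _ _
    _ ≤ K₀ / Real.log y ^ 10 + 2 / y := add_le_add (h₀ y hy) htail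
    _ ≤ K₀ / Real.log y ^ 10 + 2 * 10 ^ 10 / Real.log y ^ 10 := by linarith
    _ = (K₀ + 2 * 10 ^ 10) / Real.log y ^ 10 := by rw [add_div]

/-! ### Part 9. Hypothesis (R): level of distribution `x^{3/4}` for the squarefree numbers -/

/-- **Hypothesis (R) for `sqfreeSeq` with `D = x^{3/4}`**: for large `x` and all `t ≤ x`,
`∑_{d ≤ x^{3/4}, d sqf} |r_d(t)| ≤ A(x) (log x)^{-2^{22}}`; indeed the left side is
`≪ x^{7/8} (log x)^4` by `abs_card_dvd_sub_dens_mul_card_le` and the divisor-sum bounds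
`∑_{d ≤ D} τ(d) ≪ D (log D)^4`, `∑_{d ≤ D} τ(d)²/d ≪ (log D)^8` (`DivisorPowerSums`). [folklore] -/
theorem clause_R : ∀ᶠ x : ℝ in atTop, ∀ t : ℝ, t ≤ x →
    ∑ d ∈ (Icc 1 ⌊levelFn x⌋₊).filter Squarefree, |sqfreeSeq.remainder d t| ≤
      sqfreeSeq.size x / Real.log x ^ SieveSequence.fiLogSaving := by
  obtain ⟨C₁, hC₁, h₁⟩ := exists_sum_sigma_zero_pow_le_real 1
  obtain ⟨C₂, hC₂, h₂⟩ := exists_sum_sigma_zero_pow_div_le_real 2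
  set L : ℕ := SieveSequence.fiLogSaving with hL
  set K : ℝ := 8 * (4 * C₁ + 12 * Real.sqrt C₂) with hK
  have hK0 : 0 < K := by positivity
  have hlo := (isLittleO_log_rpow_rpow_atTop (s := 1 / 8) ((L + 4 : ℕ) : ℝ) (by norm_num)).def
    (inv_pos.2 hK0)
  filter_upwards [hlo, eventually_ge_atTop (4 : ℝ)] with x hx hx4 t htx
  have hx0 : 0 < x := by linarith
  have hx1 : 1 ≤ x := by linarith
  have hlog0 : 0 < Real.log x := Real.log_pos (by linarith)
  -- the asymptotic inequality `K (log x)^{L+4} ≤ x^{1/8}`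
  have hKlog : K * Real.log x ^ (L + 4) ≤ x ^ (1 / 8 : ℝ) := by
    have h := hx
    rw [Real.norm_of_nonneg (Real.rpow_nonneg hlog0.le _),
      Real.norm_of_nonneg (Real.rpow_nonneg hx0.le _), Real.rpow_natCast] at h
    calc K * Real.log x ^ (L + 4) ≤ K * (K⁻¹ * x ^ (1 / 8 : ℝ)) :=
          mul_le_mul_of_nonneg_left h hK0.le
      _ = x ^ (1 / 8 : ℝ) := by field_simp
  -- the level
  have hlev : levelFn x = x ^ (3 / 4 : ℝ) := rfl
  set xD : ℝ := x ^ (3 / 4 : ℝ) with hxD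
  rw [hlev]
  have hsqrt4 : Real.sqrt 4 = 2 := by
    rw [show (4 : ℝ) = 2 ^ 2 by norm_num, Real.sqrt_sq (by norm_num)]
  have hx2 : (2 : ℝ) ≤ Real.sqrt x := hsqrt4 ▸ Real.sqrt_le_sqrt hx4
  have hxDge : Real.sqrt x ≤ xD := by
    rw [Real.sqrt_eq_rpow]
    exact Real.rpow_le_rpow_of_exponent_le hx1 (by norm_num)
  have hxD2 : 2 ≤ xD := hx2.trans hxDge
  have hxDx : xD ≤ x := by
    conv_rhs => rw [← Real.rpow_one x]
    exact Real.rpow_le_rpow_of_exponent_le hx1 (by norm_num)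
  have hxD78 : xD ≤ x ^ (7 / 8 : ℝ) := Real.rpow_le_rpow_of_exponent_le hx1 (by norm_num)
  have hprod : Real.sqrt x * Real.sqrt xD = x ^ (7 / 8 : ℝ) := by
    rw [Real.sqrt_eq_rpow, Real.sqrt_eq_rpow, hxD, ← Real.rpow_mul hx0.le, ← Real.rpow_add hx0]
    norm_num
  have hlogD : Real.log xD ≤ Real.log x := Real.log_le_log (by linarith) hxDx
  have hlogD0 : 0 ≤ Real.log xD := Real.log_nonneg (by linarith)
  -- divisor sums over `d ≤ x^{3/4}`
  have hS1 : ∑ d ∈ Icc 1 ⌊xD⌋₊, (σ 0 d : ℝ) ≤ C₁ * xD * Real.log x ^ 4 := by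
    have h := h₁ xD hxD2
    simp only [pow_one] at h
    calc ∑ d ∈ Icc 1 ⌊xD⌋₊, (σ 0 d : ℝ) ≤ C₁ * xD * Real.log xD ^ (2 ^ (1 + 1)) := h
      _ ≤ C₁ * xD * Real.log x ^ (2 ^ (1 + 1)) := by gcongr
      _ = C₁ * xD * Real.log x ^ 4 := by norm_num
  have hS2 : ∑ d ∈ Icc 1 ⌊xD⌋₊, (σ 0 d : ℝ) / Real.sqrt d ≤
      Real.sqrt C₂ * Real.log x ^ 4 * Real.sqrt xD := by
    have h := h₂ xD hxD2
    have hcs := Finset.sum_mul_sq_le_sq_mul_sq (Icc 1 ⌊xD⌋₊)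
      (fun d => (σ 0 d : ℝ) / Real.sqrt d) (fun _ => (1 : ℝ))
    simp only [mul_one, one_pow, Finset.sum_const, Nat.card_Icc, nsmul_eq_mul] at hcs
    have hf2 : ∑ d ∈ Icc 1 ⌊xD⌋₊, ((σ 0 d : ℝ) / Real.sqrt d) ^ 2 =
        ∑ d ∈ Icc 1 ⌊xD⌋₊, (σ 0 d : ℝ) ^ 2 / d := by
      refine Finset.sum_congr rfl fun d _ => ?_
      rw [div_pow, Real.sq_sqrt (Nat.cast_nonneg _)]
    have hcard : ((⌊xD⌋₊ + 1 - 1 : ℕ) : ℝ) ≤ xD := by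
      rw [Nat.add_sub_cancel]
      exact Nat.floor_le (by linarith)
    have hs0 : 0 ≤ ∑ d ∈ Icc 1 ⌊xD⌋₊, (σ 0 d : ℝ) / Real.sqrt d :=
      Finset.sum_nonneg fun _ _ => by positivity
    have hsq : (∑ d ∈ Icc 1 ⌊xD⌋₊, (σ 0 d : ℝ) / Real.sqrt d) ^ 2 ≤
        (Real.sqrt C₂ * Real.log x ^ 4 * Real.sqrt xD) ^ 2 := by
      calc (∑ d ∈ Icc 1 ⌊xD⌋₊, (σ 0 d : ℝ) / Real.sqrt d) ^ 2
          ≤ (∑ d ∈ Icc 1 ⌊xD⌋₊, ((σ 0 d : ℝ) / Real.sqrt d) ^ 2) * ((⌊xD⌋₊ + 1 - 1 : ℕ) : ℝ) := hcs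
        _ = (∑ d ∈ Icc 1 ⌊xD⌋₊, (σ 0 d : ℝ) ^ 2 / d) * ((⌊xD⌋₊ + 1 - 1 : ℕ) : ℝ) := by rw [hf2]
        _ ≤ (C₂ * Real.log xD ^ (2 ^ (2 + 1))) * xD :=
            mul_le_mul h hcard (Nat.cast_nonneg _) (by positivity)
        _ ≤ (C₂ * Real.log x ^ (2 ^ (2 + 1))) * xD := by gcongr
        _ = (Real.sqrt C₂ * Real.log x ^ 4 * Real.sqrt xD) ^ 2 := by
            rw [mul_pow, mul_pow, Real.sq_sqrt hC₂.le, Real.sq_sqrt (by linarith), ← pow_mul]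
            norm_num
    exact (pow_le_pow_iff_left₀ hs0 (by positivity) two_ne_zero).1 hsq
  -- `N = ⌊t⌋ ≤ x`
  set N : ℕ := ⌊t⌋₊ with hN
  have hNx : (N : ℝ) ≤ x := by
    rcases le_or_gt 0 t with ht0 | ht0
    · exact (Nat.floor_le ht0).trans htx
    · rw [hN, Nat.floor_of_nonpos ht0.le, Nat.cast_zero]
      exact hx0.le
  -- pointwise bound for each squarefree `d`
  have hterm : ∀ d ∈ (Icc 1 ⌊xD⌋₊).filter Squarefree,
      |sqfreeSeq.remainder d t| ≤
        4 * (σ 0 d : ℝ) + 12 * Real.sqrt x * ((σ 0 d : ℝ) / Real.sqrt d) := by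
    intro d hd
    rw [Finset.mem_filter, Finset.mem_Icc] at hd
    have hdsq : Squarefree d := hd.2
    rw [SieveSequence.remainder, sqfreeSeq_congrSum, sqfreeSeq_size_eq]
    change |_ - dens d * _| ≤ _
    refine (abs_card_dvd_sub_dens_mul_card_le hdsq N).trans ?_
    have hsd : Real.sqrt ((N : ℝ) / d) ≤ Real.sqrt x / Real.sqrt d := by
      rw [Real.sqrt_div (Nat.cast_nonneg _)]
      gcongr
    calc 4 * (σ 0 d : ℝ) + 12 * (σ 0 d : ℝ) * Real.sqrt ((N : ℝ) / d)
        ≤ 4 * (σ 0 d : ℝ) + 12 * (σ 0 d : ℝ) * (Real.sqrt x / Real.sqrt d) := by gcongr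
      _ = 4 * (σ 0 d : ℝ) + 12 * Real.sqrt x * ((σ 0 d : ℝ) / Real.sqrt d) := by ring
  -- summing over `d`
  have hsum : ∑ d ∈ (Icc 1 ⌊xD⌋₊).filter Squarefree, |sqfreeSeq.remainder d t| ≤
      (4 * C₁ + 12 * Real.sqrt C₂) * x ^ (7 / 8 : ℝ) * Real.log x ^ 4 := by
    calc ∑ d ∈ (Icc 1 ⌊xD⌋₊).filter Squarefree, |sqfreeSeq.remainder d t|
        ≤ ∑ d ∈ (Icc 1 ⌊xD⌋₊).filter Squarefree,
            (4 * (σ 0 d : ℝ) + 12 * Real.sqrt x * ((σ 0 d : ℝ) / Real.sqrt d)) :=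
          Finset.sum_le_sum hterm
      _ ≤ ∑ d ∈ Icc 1 ⌊xD⌋₊, (4 * (σ 0 d : ℝ) + 12 * Real.sqrt x * ((σ 0 d : ℝ) / Real.sqrt d)) :=
          Finset.sum_le_sum_of_subset_of_nonneg (Finset.filter_subset _ _)
            fun _ _ _ => by positivity
      _ = 4 * ∑ d ∈ Icc 1 ⌊xD⌋₊, (σ 0 d : ℝ) +
            12 * Real.sqrt x * ∑ d ∈ Icc 1 ⌊xD⌋₊, (σ 0 d : ℝ) / Real.sqrt d := by
          rw [Finset.sum_add_distrib, ← Finset.mul_sum, ← Finset.mul_sum]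
      _ ≤ 4 * (C₁ * xD * Real.log x ^ 4) +
            12 * Real.sqrt x * (Real.sqrt C₂ * Real.log x ^ 4 * Real.sqrt xD) := by gcongr
      _ = (4 * C₁ * xD + 12 * Real.sqrt C₂ * (Real.sqrt x * Real.sqrt xD)) * Real.log x ^ 4 := by
          ring
      _ ≤ (4 * C₁ * x ^ (7 / 8 : ℝ) + 12 * Real.sqrt C₂ * x ^ (7 / 8 : ℝ)) * Real.log x ^ 4 := by
          rw [hprod]; gcongr
      _ = (4 * C₁ + 12 * Real.sqrt C₂) * x ^ (7 / 8 : ℝ) * Real.log x ^ 4 := by ring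
  -- comparison with `A(x)(log x)^{-L}`
  have hxsplit : x ^ (1 / 8 : ℝ) * x ^ (7 / 8 : ℝ) = x := by
    rw [← Real.rpow_add hx0]; norm_num
  have hfinal : (4 * C₁ + 12 * Real.sqrt C₂) * x ^ (7 / 8 : ℝ) * Real.log x ^ 4 ≤
      sqfreeSeq.size x / Real.log x ^ L := by
    rw [le_div_iff₀ (pow_pos hlog0 L)]
    calc (4 * C₁ + 12 * Real.sqrt C₂) * x ^ (7 / 8 : ℝ) * Real.log x ^ 4 * Real.log x ^ L
        = K * Real.log x ^ (L + 4) * x ^ (7 / 8 : ℝ) / 8 := by rw [hK]; ring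
      _ ≤ x ^ (1 / 8 : ℝ) * x ^ (7 / 8 : ℝ) / 8 := by gcongr
      _ = x / 8 := by rw [hxsplit]
      _ ≤ sqfreeSeq.size x := sqfreeSeq_size_ge (by linarith)
  exact hsum.trans hfinal

/-- **All hypotheses of FI Theorem 1 hold for the witness**: `sqfreeSeq` with `D = x^{3/4}`,
`δ = 2√x`, `Δ = exp(x³)` satisfies `SieveSequence.FIAsymptoticSieveHypotheses`. [folklore] -/
theorem hypotheses : sqfreeSeq.FIAsymptoticSieveHypotheses levelFn deltaFn bigDeltaFn :=
  ⟨fun _ => rfl, clause_14, clause_16, clause_18, clause_19,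
    fun n hn => by change LFunctions.sqfreeInd n = 0; unfold LFunctions.sqfreeInd; rw [if_neg hn],
    clause_R1, clause_R, clause_B⟩

/-! ### Part 10. The Euler product `H = ∏_p (1 - g(p))(1 - 1/p)⁻¹ = ∏_p p²/(p² - 1)` converges -/

/-- The Euler factor of the density constant: `(1 - 1/(p+1))/(1 - 1/p) = 1 + 1/(p² - 1)`. [folklore] -/
theorem eulerFactor_eq {p : ℕ} (hp : p.Prime) :
    (1 - sqfreeSeq.density p) / (1 - (p : ℝ)⁻¹) = 1 + 1 / ((p : ℝ) ^ 2 - 1) := by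
  change (1 - dens p) / _ = _
  rw [dens_apply_prime hp]
  have hp2 : (2 : ℝ) ≤ p := by exact_mod_cast hp.two_le
  have h1 : (p : ℝ) - 1 ≠ 0 := (by linarith : (0 : ℝ) < p - 1).ne'
  have h2 : (p : ℝ) + 1 ≠ 0 := (by linarith : (0 : ℝ) < p + 1).ne'
  have h3 : (p : ℝ) ^ 2 - 1 ≠ 0 := (by nlinarith : (0 : ℝ) < p ^ 2 - 1).ne'
  have hp0 : (p : ℝ) ≠ 0 := (by linarith : (0 : ℝ) < p).ne'
  field_simp
  ring

/-- `1 ≤ (1 - g(p))/(1 - 1/p) ≤ exp(2/p²)`. [folklore] -/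
theorem one_le_eulerFactor {p : ℕ} (hp : p.Prime) :
    1 ≤ (1 - sqfreeSeq.density p) / (1 - (p : ℝ)⁻¹) ∧
      (1 - sqfreeSeq.density p) / (1 - (p : ℝ)⁻¹) ≤ Real.exp (2 / (p : ℝ) ^ 2) := by
  rw [eulerFactor_eq hp]
  have hp2 : (2 : ℝ) ≤ p := by exact_mod_cast hp.two_le
  have hp3 : (3 : ℝ) ≤ (p : ℝ) ^ 2 - 1 := by nlinarith
  refine ⟨by linarith [show (0 : ℝ) ≤ 1 / ((p : ℝ) ^ 2 - 1) from by positivity], ?_⟩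
  have hle : 1 / ((p : ℝ) ^ 2 - 1) ≤ 2 / (p : ℝ) ^ 2 := by
    rw [div_le_div_iff₀ (by linarith) (by positivity)]
    nlinarith
  have := Real.add_one_le_exp (2 / (p : ℝ) ^ 2)
  linarith

/-- The ordered partial Euler products `P(n) = ∏_{p ≤ n} (1 - g(p))(1 - 1/p)⁻¹`. [folklore] -/
def eulerPartial (n : ℕ) : ℝ :=
  ∏ p ∈ Nat.primesLE n, (1 - sqfreeSeq.density p) / (1 - (p : ℝ)⁻¹)

/-- `P(n) ≥ 0`. [folklore] -/
theorem eulerPartial_nonneg (n : ℕ) : 0 ≤ eulerPartial n :=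
  Finset.prod_nonneg fun _ hp =>
    zero_le_one.trans (one_le_eulerFactor (Nat.prime_of_mem_primesLE hp)).1

/-- `P` is nondecreasing (all factors are `≥ 1`). [folklore] -/
theorem eulerPartial_mono : Monotone eulerPartial := by
  refine monotone_nat_of_le_succ fun n => ?_
  unfold eulerPartial
  rw [Nat.primesLE_succ]
  split_ifs with hp
  · rw [Finset.prod_insert (Nat.notMem_primesLE n)]
    exact le_mul_of_one_le_left (eulerPartial_nonneg n) (one_le_eulerFactor hp).1
  · exact le_rfl

/-- `P(n) ≤ e²` (`P(n) ≤ exp(∑_{p ≤ n} 2/p²) ≤ exp 2`). [folklore] -/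
theorem eulerPartial_le (n : ℕ) : eulerPartial n ≤ Real.exp 2 := by
  unfold eulerPartial
  calc ∏ p ∈ Nat.primesLE n, (1 - sqfreeSeq.density p) / (1 - (p : ℝ)⁻¹)
      ≤ ∏ p ∈ Nat.primesLE n, Real.exp (2 / (p : ℝ) ^ 2) :=
        Finset.prod_le_prod
          (fun p hp => zero_le_one.trans (one_le_eulerFactor (Nat.prime_of_mem_primesLE hp)).1)
          fun p hp => (one_le_eulerFactor (Nat.prime_of_mem_primesLE hp)).2
    _ = Real.exp (∑ p ∈ Nat.primesLE n, 2 / (p : ℝ) ^ 2) := (Real.exp_sum _ _).symm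
    _ ≤ Real.exp 2 := by
        refine Real.exp_le_exp.2 ?_
        calc ∑ p ∈ Nat.primesLE n, 2 / (p : ℝ) ^ 2 ≤ ∑ k ∈ Ioc 1 n, 2 / (k : ℝ) ^ 2 := by
              refine Finset.sum_le_sum_of_subset_of_nonneg ?_ fun _ _ _ => by positivity
              intro p hp
              rw [Nat.mem_primesLE] at hp
              rw [Finset.mem_Ioc]
              exact ⟨hp.2.one_lt, hp.1⟩
          _ = 2 * ∑ k ∈ Ioc 1 n, 1 / (k : ℝ) ^ 2 := by
              rw [Finset.mul_sum]
              exact Finset.sum_congr rfl fun k _ => by ring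
          _ ≤ 2 * (1 / (1 : ℕ)) :=
              mul_le_mul_of_nonneg_left (LFunctions.sum_Ioc_one_div_sq_le le_rfl) (by norm_num)
          _ = 2 := by norm_num

/-- **The density constant exists**: the ordered Euler product `∏_{p ≤ n} (1 - g(p))(1 - 1/p)⁻¹`
converges (nondecreasing and bounded; its value `ζ(2)` is not needed). [folklore] -/
theorem exists_hasDensityConstant : ∃ H : ℝ, sqfreeSeq.HasDensityConstant H :=
  ⟨⨆ n, eulerPartial n, tendsto_atTop_ciSup eulerPartial_mono
    ⟨Real.exp 2, by rintro _ ⟨n, rfl⟩; exact eulerPartial_le n⟩⟩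

/-! ### Part 11. The contradiction -/

/-- `A(n) = ∑_{k ≤ n} μ²(k)` at an integer point. [folklore] -/
theorem sqfreeSeq_size_natCast (n : ℕ) : sqfreeSeq.size (n : ℝ) = ∑ k ∈ Ioc 0 n, LFunctions.sqfreeInd k := by
  change ∑ k ∈ (Ioc 0 ⌊(n : ℝ)⌋₊).filter (fun k => 1 ∣ k), LFunctions.sqfreeInd k = _
  rw [Nat.floor_natCast, Finset.filter_true_of_mem fun k _ => one_dvd k]

/-- The jump of `A` at a prime: `A(p) = A(p - 1) + 1`. [folklore] -/
theorem sqfreeSeq_size_prime {p : ℕ} (hp : p.Prime) :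
    sqfreeSeq.size (p : ℝ) = sqfreeSeq.size ((p - 1 : ℕ) : ℝ) + 1 := by
  rw [sqfreeSeq_size_natCast, sqfreeSeq_size_natCast]
  have hp1 : p - 1 + 1 = p := Nat.sub_add_cancel hp.one_le
  conv_lhs => rw [← hp1]
  rw [Finset.sum_Ioc_succ_top (Nat.zero_le _), hp1]
  congr 1
  unfold LFunctions.sqfreeInd
  rw [if_pos hp.prime.squarefree]

/-- The jump of `S(x) = ∑_{q ≤ x} a_q log q` at a prime: `S(p) = S(p - 1) + log p`. [folklore] -/
theorem sqfreeSeq_primeSum_prime {p : ℕ} (hp : p.Prime) :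
    ∑ q ∈ Nat.primesLE p, sqfreeSeq.a q * Real.log q =
      ∑ q ∈ Nat.primesLE (p - 1), sqfreeSeq.a q * Real.log q + Real.log p := by
  have hp1 : p - 1 + 1 = p := Nat.sub_add_cancel hp.one_le
  have h := Nat.primesLE_succ (p - 1)
  rw [hp1, if_pos hp] at h
  have hnot : p ∉ Nat.primesLE (p - 1) := fun h' => by
    have := Nat.le_of_mem_primesLE h'
    have := hp.two_le
    omega
  rw [h, Finset.sum_insert hnot, add_comm]
  congr 1
  change LFunctions.sqfreeInd p * Real.log p = Real.log p
  unfold LFunctions.sqfreeInd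
  rw [if_pos hp.prime.squarefree, one_mul]

end FICounterexample

open FICounterexample in
/-- **The literal reading of Friedlander–Iwaniec's Theorem 1 (1.17) — FI's hypotheses for SOME
parameter functions `δ, Δ ≥ 2` give `∑_{p ≤ x} a_p log p = H A(x)(1 + O(log δ / log Δ))` — is
false** (the negated statement is, verbatim, the body of the named fact `fi_asymptotic_sieve_primes`
of `AsymptoticSieveForPrimes.lean`, retired as refuted on 2026-08-15; it is spelled out so that this
theorem survives the deletion of that `def`). For the squarefree numbers
(`a_n = μ²(n)`, `g(p) = 1/(p+1)`, level `D = x^{3/4}`) all of FI's hypotheses hold with the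
admissible but degenerate parameters `δ = 2√x` (which empties the range (B1), so that (B) holds
vacuously) and `Δ = exp(x³)`; the conclusion (1.17) would then give
`∑_{p ≤ x} log p - H A(x) = O(H A(x) log(2√x)/x³) = O(1)`-small, in fact `→ 0`, whereas this
function of `x` jumps by `log p - H → ∞` at every prime `p`. (The printed Theorem 1 is meant in
the regime "`δ` a power of `log x`, `Δ` a small power of `x`", p. 1044, vendored as
`fi_asymptotic_sieve_primes_loglog` and proved as `fi_asymptotic_sieve_primes_loglog_holds`.)
[cite: FriedlanderIwaniecASP1998, Theorem 1 (1.17) and p. 1044] -/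
theorem fi_asymptotic_sieve_primes_false :
    ¬∀ (A : SieveSequence) (D δ Δ : ℝ → ℝ) (H : ℝ),
      A.FIAsymptoticSieveHypotheses D δ Δ → A.HasDensityConstant H →
        (fun x : ℝ => (∑ p ∈ Nat.primesLE ⌊x⌋₊, A.a p * Real.log p) - H * A.size x) =O[atTop]
          fun x : ℝ => H * A.size x * (Real.log (δ x) / Real.log (Δ x)) := by
  intro hASP
  obtain ⟨H, hH⟩ := exists_hasDensityConstant
  have hO := hASP sqfreeSeq levelFn deltaFn bigDeltaFn H hypotheses hH
  obtain ⟨C, hC0, hC⟩ := hO.exists_nonneg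
  rw [Asymptotics.IsBigOWith] at hC
  set f : ℝ → ℝ := fun x =>
    (∑ p ∈ Nat.primesLE ⌊x⌋₊, sqfreeSeq.a p * Real.log p) - H * sqfreeSeq.size x with hf
  have hbound : ∀ᶠ x : ℝ in atTop, |f x| ≤ 2 * C * |H| := by
    filter_upwards [hC, eventually_ge_atTop (1 : ℝ)] with x hx hx1
    have hx0 : 0 < x := by linarith
    have hsz : sqfreeSeq.size x ≤ x := sqfreeSeq_size_le hx0.le
    have hsz0 : 0 ≤ sqfreeSeq.size x := sqfreeSeq_size_nonneg x
    have hlogΔ : Real.log (bigDeltaFn x) = x ^ 3 := Real.log_exp _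
    have hsx1 : 1 ≤ Real.sqrt x := Real.one_le_sqrt.2 hx1
    have hlogδ0 : 0 ≤ Real.log (deltaFn x) := Real.log_nonneg (by unfold deltaFn; linarith)
    have hlogδ : Real.log (deltaFn x) ≤ 2 * x := by
      have h1 := Real.log_le_sub_one_of_pos (by unfold deltaFn; linarith : 0 < deltaFn x)
      have h2 : Real.sqrt x ≤ x := by
        rw [Real.sqrt_le_left hx0.le]
        nlinarith
      unfold deltaFn at h1 ⊢
      linarith
    have hg : ‖H * sqfreeSeq.size x * (Real.log (deltaFn x) / Real.log (bigDeltaFn x))‖ ≤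
        2 * |H| := by
      rw [hlogΔ, Real.norm_eq_abs, abs_mul, abs_mul, abs_of_nonneg hsz0,
        abs_of_nonneg (div_nonneg hlogδ0 (by positivity))]
      calc |H| * sqfreeSeq.size x * (Real.log (deltaFn x) / x ^ 3)
          ≤ |H| * x * (2 * x / x ^ 3) := by gcongr
        _ = 2 * |H| * (1 / x) := by field_simp
        _ ≤ 2 * |H| * 1 := by
            gcongr
            rw [div_le_one hx0]
            exact hx1
        _ = 2 * |H| := mul_one _
    calc |f x| = ‖f x‖ := (Real.norm_eq_abs _).symm
      _ ≤ C * ‖H * sqfreeSeq.size x * (Real.log (deltaFn x) / Real.log (bigDeltaFn x))‖ := hx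
      _ ≤ C * (2 * |H|) := mul_le_mul_of_nonneg_left hg hC0
      _ = 2 * C * |H| := by ring
  obtain ⟨x₀, hx₀⟩ := Filter.eventually_atTop.1 hbound
  set B : ℝ := 2 * C * |H| with hB
  obtain ⟨p, hpge, hp⟩ :=
    Nat.exists_infinite_primes (max (⌈x₀⌉₊ + 1) (⌊Real.exp (|H| + 2 * B)⌋₊ + 1))
  have hp1 : x₀ ≤ ((p - 1 : ℕ) : ℝ) := by
    have h1 : ⌈x₀⌉₊ + 1 ≤ p := le_of_max_le_left hpge
    have h2 : (⌈x₀⌉₊ : ℝ) ≤ ((p - 1 : ℕ) : ℝ) := by exact_mod_cast (by omega : ⌈x₀⌉₊ ≤ p - 1)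
    exact (Nat.le_ceil x₀).trans h2
  have hp2 : x₀ ≤ (p : ℝ) := hp1.trans (by exact_mod_cast Nat.sub_le p 1)
  have hlogp : |H| + 2 * B < Real.log p := by
    have h1 : ⌊Real.exp (|H| + 2 * B)⌋₊ + 1 ≤ p := le_of_max_le_right hpge
    have h2 : Real.exp (|H| + 2 * B) < p :=
      calc Real.exp (|H| + 2 * B) < (⌊Real.exp (|H| + 2 * B)⌋₊ : ℝ) + 1 := Nat.lt_floor_add_one _
        _ ≤ p := by exact_mod_cast h1
    rwa [Real.lt_log_iff_exp_lt (by exact_mod_cast hp.pos)]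
  have hjump : f p - f ((p - 1 : ℕ) : ℝ) = Real.log p - H := by
    simp only [hf, Nat.floor_natCast]
    rw [sqfreeSeq_primeSum_prime hp, sqfreeSeq_size_prime hp]
    ring
  have h1 := hx₀ _ hp2
  have h2 := hx₀ _ hp1
  have h3 : Real.log p - H ≤ 2 * B := by
    rw [← hjump]
    have e1 : f p - f ((p - 1 : ℕ) : ℝ) ≤ |f p - f ((p - 1 : ℕ) : ℝ)| := le_abs_self _
    have e2 : |f p - f ((p - 1 : ℕ) : ℝ)| ≤ |f p| + |f ((p - 1 : ℕ) : ℝ)| := abs_sub _ _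
    linarith
  have h4 : H ≤ |H| := le_abs_self H
  linarith

/-- `fi_asymptotic_sieve_primes_false` under the `not_<decl>` name of the retired named fact
`fi_asymptotic_sieve_primes` (D-0026 verdict clean-up: the refuting theorem of a refuted fact is
kept as `theorem not_<decl> : ¬ <statement>`). [cite: FriedlanderIwaniecASP1998, Theorem 1 (1.17) and p. 1044] -/
theorem not_fi_asymptotic_sieve_primes :
    ¬∀ (A : SieveSequence) (D δ Δ : ℝ → ℝ) (H : ℝ),
      A.FIAsymptoticSieveHypotheses D δ Δ → A.HasDensityConstant H →
        (fun x : ℝ => (∑ p ∈ Nat.primesLE ⌊x⌋₊, A.a p * Real.log p) - H * A.size x) =O[atTop]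
          fun x : ℝ => H * A.size x * (Real.log (δ x) / Real.log (Δ x)) :=
  fi_asymptotic_sieve_primes_false

end Literature.NumberTheory.Sieve
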